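import Literature.Analysis.FluidPDE.NSRobustnessOfRegularityAgmonBound
import Literature.Analysis.FluidPDE.NSRobustnessOfRegularityH2
import HarnessLib

/-!
# Robustness of regularity on `ℝ³`, `AgmonBoundR3` RE-THREAD III: the `H²` slice inequality in strain form with the
# Agmon constant as a PARAMETER

Analysis/FluidPDE proof file (theorems only; no definitions, no named facts, no `sorry`); third file of the
re-thread of the vein over `(hA : AgmonBoundR3 A)`. VERBATIM copy of `robustness_flux_H2_le_strain_R3`
(Dashti–Robinson 2008, proof of Thm 2, strain form; `NSRobustnessOfRegularityH2`) with `agmonConst ↦ A`: the two Agmon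
uses (the sup of `w` in the transport coefficient `2A²√(X₁Y₂)/ν`, the sup of `∂ᵢw` in the pairing `∫⟪Dw(∂ᵢw), Δ∂ᵢw⟫`)
go through `hA.norm_le`; the finiteness hypotheses `Dⁿw ∈ L²`, `n ≤ 4`, become `∀ n`. The per-direction slice
calculus (§A–§B: Young, Cauchy–Schwarz, the IBP identities, the third-order pairing, the six pairings
`r3rob_H2_pairings`, the symmetric term, the three-direction bookkeeping) is the vein's private calculus COPIED
verbatim (private declarations cannot be imported or re-opened append-only).

* `robustness_flux_H2_le_strain_of_agmonBound`.

WHAT THIS IS NOT: not a statement about Navier–Stokes regularity or blow-up — slice calculus for two given smooth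
fields. Consumer: `classicalNS_robustness_H2_strain_of_agmonBound` (next file), then the numeral certificate letters
of crux 20303 (`EpisodeBaseT`), cell `ns-blowup`.

## References

* M. Dashti, J. C. Robinson, SIAM J. Numer. Anal. 46 (2008) 3136–3150, Thm 2 (proof). [DashtiRobinson2008]
* J. C. Robinson, J. L. Rodrigo, W. Sadowski, *The Three-Dimensional Navier–Stokes Equations*, CUP 2016,
  Thm 9.1 (proof, Step 1), Thm 1.20. [RobinsonRodrigoSadowskiCUP2016]
-/

noncomputable section

open MeasureTheory Set Function Filter Topology InnerProductSpace
open scoped ENNReal NNReal ContDiff RealInnerProductSpace Laplacian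

namespace Literature.Analysis.FluidPDE

/-! ## §A Slice calculus repeated from the vein (private copies) -/

section Helpers

/-- `M √X √Y ≤ (ν/4) Y + M²X/ν` (`(νb − 2Ma)² ≥ 0`). [folklore] -/
private theorem r3rob_young_two {ν M X Y : ℝ} (hν : 0 < ν) (hX : 0 ≤ X) (hY : 0 ≤ Y) :
    M * Real.sqrt X * Real.sqrt Y ≤ ν / 4 * Y + M ^ 2 * X / ν := by
  have ha := Real.sq_sqrt hX
  have hb := Real.sq_sqrt hY
  set a := Real.sqrt X
  set b := Real.sqrt Y
  rw [← ha, ← hb]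
  have key : 0 ≤ (ν * b - 2 * M * a) ^ 2 := sq_nonneg _
  rw [show ν / 4 * b ^ 2 + M ^ 2 * a ^ 2 / ν = (ν ^ 2 * b ^ 2 + 4 * M ^ 2 * a ^ 2) / (4 * ν) by
    field_simp]
  rw [le_div_iff₀ (by positivity)]
  nlinarith [key]

/-- **The polynomial Young step** (RRS: "Young's inequality with exponents `4` and `4/3`"):
if `s ≥ 0` and `s⁴ ≤ K Y³` with `K, Y ≥ 0`, then `s ≤ εY + 27K/(256ε³)` for every `ε > 0`
(`(3p + c)⁴ − 256p³c = (p − c)²(81p² + 14pc + c²) ≥ 0`). [folklore] -/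
private theorem r3rob_young_quartic {s K Y ε : ℝ} (hs : 0 ≤ s) (hK : 0 ≤ K) (hY : 0 ≤ Y)
    (hε : 0 < ε) (h : s ^ 4 ≤ K * Y ^ 3) : s ≤ ε * Y + 27 * K / (256 * ε ^ 3) := by
  set c : ℝ := 27 * K / (256 * ε ^ 3) with hc
  have hc0 : 0 ≤ c := by positivity
  set p : ℝ := ε * Y / 3 with hp
  have hp0 : 0 ≤ p := by positivity
  have hamgm : 256 * p ^ 3 * c ≤ (3 * p + c) ^ 4 := by
    have hid : (3 * p + c) ^ 4 - 256 * p ^ 3 * c =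
        (p - c) ^ 2 * (81 * p ^ 2 + 14 * p * c + c ^ 2) := by ring
    have hnn : 0 ≤ (p - c) ^ 2 * (81 * p ^ 2 + 14 * p * c + c ^ 2) := by positivity
    linarith
  have he : 256 * p ^ 3 * c = K * Y ^ 3 := by
    rw [hp, hc]; field_simp; ring
  have h3p : 3 * p + c = ε * Y + c := by rw [hp]; ring
  have hle4 : s ^ 4 ≤ (ε * Y + c) ^ 4 := by
    rw [← h3p]
    exact h.trans (he ▸ hamgm)
  have hrhs : 0 ≤ ε * Y + c := by positivity
  exact (pow_le_pow_iff_left₀ hs hrhs (by norm_num)).1 hle4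


/-- `∫⁻‖c‖a‖‖² < ∞` from `∫⁻‖a‖² < ∞` (real-valued majorant form). [folklore] -/
private theorem r3rob_lintegral_sq_mul_norm_lt_top {G : Type*} [NormedAddCommGroup G]
    {a : EuclideanSpace ℝ (Fin 3) → G}
    (c : ℝ) (ha : ∫⁻ x, ‖a x‖ₑ ^ 2 < ⊤) : ∫⁻ x, ‖c * ‖a x‖‖ₑ ^ 2 < ⊤ := by
  have e : ∀ x, ‖c * ‖a x‖‖ₑ ^ 2 = ‖c‖ₑ ^ 2 * ‖a x‖ₑ ^ 2 := fun x => by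
    rw [enorm_mul, mul_pow, enorm_norm]
  simp_rw [e]
  rw [lintegral_const_mul' _ _ (ENNReal.pow_ne_top enorm_ne_top)]
  exact ENNReal.mul_lt_top (lt_top_iff_ne_top.2 (ENNReal.pow_ne_top enorm_ne_top)) ha


/-- A continuous field with `∫‖k‖² < ∞` is in `L²`. [folklore] -/
private theorem r3rob_memLp_two {G : Type*} [NormedAddCommGroup G]
    {k : EuclideanSpace ℝ (Fin 3) → G}
    (hk : Continuous k) (hk0 : ∫⁻ x, ‖k x‖ₑ ^ 2 < ⊤) : MemLp k 2 volume :=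
  (memLp_two_iff_integrable_sq_norm hk.aestronglyMeasurable).2
    (FluidPDE.integrable_sq_norm_of_lintegral_lt_top hk hk0)

/-- Pointwise: `‖(f·∇)h (x)‖ ≤ ‖f(x)‖ (|∇h(x)|²_F)^{1/2}` (`‖Dh(x)a‖ ≤ ‖Dh(x)‖‖a‖` and the
operator norm is at most the Frobenius norm, `sq_opNorm_le_frobeniusNormSq`). [folklore] -/
private theorem norm_convect_le_mul_sqrt_frobeniusNormSq
    (f h : EuclideanSpace ℝ (Fin 3) → EuclideanSpace ℝ (Fin 3)) (x : EuclideanSpace ℝ (Fin 3)) :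
    ‖convect f h x‖ ≤ ‖f x‖ * Real.sqrt (frobeniusNormSq (fderiv ℝ h x)) := by
  have h1 : ‖convect f h x‖ ≤ ‖fderiv ℝ h x‖ * ‖f x‖ := by
    rw [convect]
    exact (fderiv ℝ h x).le_opNorm (f x)
  have h2 : ‖fderiv ℝ h x‖ ≤ Real.sqrt (frobeniusNormSq (fderiv ℝ h x)) := by
    refine Real.le_sqrt_of_sq_le ?_
    exact FluidPDE.sq_opNorm_le_frobeniusNormSq _
  calc ‖convect f h x‖ ≤ ‖fderiv ℝ h x‖ * ‖f x‖ := h1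
    _ ≤ Real.sqrt (frobeniusNormSq (fderiv ℝ h x)) * ‖f x‖ :=
        mul_le_mul_of_nonneg_right h2 (norm_nonneg _)
    _ = ‖f x‖ * Real.sqrt (frobeniusNormSq (fderiv ℝ h x)) := mul_comm _ _

/-- Integrability of a convective pairing: for continuous `f` with `‖f‖ ≤ M`, `h ∈ C¹` with
`∫|∇h|²_F < ∞` and continuous `k ∈ L²`, `⟪(f·∇)h, k⟫ ∈ L¹(ℝ³)`. [folklore] -/
private theorem integrable_inner_convect_of_norm_le
    {f h k : EuclideanSpace ℝ (Fin 3) → EuclideanSpace ℝ (Fin 3)} (hf : Continuous f)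
    (hh : ContDiff ℝ 1 h) (hk : Continuous k) {M : ℝ} (hM0 : 0 ≤ M) (hM : ∀ x, ‖f x‖ ≤ M)
    (hh1 : ∫⁻ x, ENNReal.ofReal (frobeniusNormSq (fderiv ℝ h x)) < ⊤)
    (hk0 : ∫⁻ x, ‖k x‖ₑ ^ 2 < ⊤) :
    Integrable (fun x => ⟪convect f h x, k x⟫) volume := by
  set gF : EuclideanSpace ℝ (Fin 3) → ℝ :=
    fun x => M * Real.sqrt (frobeniusNormSq (fderiv ℝ h x)) with hgF
  have cfrob : Continuous fun x => frobeniusNormSq (fderiv ℝ h x) :=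
    FluidPDE.continuous_frobeniusNormSq_fderiv hh one_ne_zero
  have cgF : Continuous gF := continuous_const.mul cfrob.sqrt
  have hgF0 : ∀ x, 0 ≤ gF x := fun x => mul_nonneg hM0 (Real.sqrt_nonneg _)
  have hgF2 : ∫⁻ x, ‖gF x‖ₑ ^ 2 < ⊤ := by
    have e : ∀ x, ‖gF x‖ₑ ^ 2 =
        ENNReal.ofReal (M ^ 2) * ENNReal.ofReal (frobeniusNormSq (fderiv ℝ h x)) := by
      intro x
      rw [Real.enorm_eq_ofReal (hgF0 x), ← ENNReal.ofReal_pow (hgF0 x), hgF, mul_pow,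
        Real.sq_sqrt (frobeniusNormSq_nonneg _), ENNReal.ofReal_mul (sq_nonneg _)]
    simp_rw [e]
    rw [lintegral_const_mul' _ _ ENNReal.ofReal_ne_top]
    exact ENNReal.mul_lt_top ENNReal.ofReal_lt_top hh1
  have cconv : Continuous (convect f h) := (hh.continuous_fderiv one_ne_zero).clm_apply hf
  refine integrable_of_norm_le_mul_of_lintegral_sq (cconv.inner hk).aestronglyMeasurable cgF hk
    hgF2 hk0 (fun x => ?_)
  calc ‖⟪convect f h x, k x⟫‖ ≤ ‖convect f h x‖ * ‖k x‖ := norm_inner_le_norm _ _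
    _ ≤ (‖f x‖ * Real.sqrt (frobeniusNormSq (fderiv ℝ h x))) * ‖k x‖ :=
        mul_le_mul_of_nonneg_right (norm_convect_le_mul_sqrt_frobeniusNormSq f h x) (norm_nonneg _)
    _ ≤ gF x * ‖k x‖ :=
        mul_le_mul_of_nonneg_right (mul_le_mul_of_nonneg_right (hM x) (Real.sqrt_nonneg _))
          (norm_nonneg _)
    _ = ‖gF x‖ * ‖k x‖ := by rw [Real.norm_of_nonneg (hgF0 x)]

/-- **Cauchy–Schwarz for a convective pairing on `ℝ³`** (RRS 2016, proof of Thm 9.1, Step 1,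
the Hölder step): for continuous `f` with `‖f‖ ≤ M`, `h ∈ C¹` with `∫|∇h|²_F < ∞` and continuous
`k ∈ L²`, `∫⟪(f·∇)h, k⟫ ≤ M (∫|∇h|²_F)^{1/2} (∫‖k‖²)^{1/2}`. [folklore] -/
private theorem integral_inner_convect_le_of_norm_le
    {f h k : EuclideanSpace ℝ (Fin 3) → EuclideanSpace ℝ (Fin 3)} (hh : ContDiff ℝ 1 h)
    (hk : Continuous k) {M : ℝ} (hM0 : 0 ≤ M) (hM : ∀ x, ‖f x‖ ≤ M)
    (hh1 : ∫⁻ x, ENNReal.ofReal (frobeniusNormSq (fderiv ℝ h x)) < ⊤)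
    (hk0 : ∫⁻ x, ‖k x‖ₑ ^ 2 < ⊤) :
    ∫ x, ⟪convect f h x, k x⟫ ≤
      M * Real.sqrt (∫ x, frobeniusNormSq (fderiv ℝ h x)) * Real.sqrt (∫ x, ‖k x‖ ^ 2) := by
  set gF : EuclideanSpace ℝ (Fin 3) → ℝ :=
    fun x => Real.sqrt (frobeniusNormSq (fderiv ℝ h x)) with hgF
  have cfrob : Continuous fun x => frobeniusNormSq (fderiv ℝ h x) :=
    FluidPDE.continuous_frobeniusNormSq_fderiv hh one_ne_zero
  have cgF : Continuous gF := cfrob.sqrt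
  have hgF0 : ∀ x, 0 ≤ gF x := fun x => Real.sqrt_nonneg _
  have hgFsq : ∀ x, gF x ^ 2 = frobeniusNormSq (fderiv ℝ h x) := fun x =>
    Real.sq_sqrt (frobeniusNormSq_nonneg _)
  -- `gF ∈ L²`
  have hgF2 : ∫⁻ x, ‖gF x‖ₑ ^ 2 < ⊤ := by
    refine lt_of_le_of_lt (le_of_eq (lintegral_congr fun x => ?_)) hh1
    rw [Real.enorm_eq_ofReal (hgF0 x), ← ENNReal.ofReal_pow (hgF0 x), hgFsq]
  have mgF : MemLp gF 2 volume := r3rob_memLp_two cgF hgF2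
  have mk : MemLp k 2 volume := r3rob_memLp_two hk hk0
  have hcs := integral_norm_mul_norm_le_sqrt_mul_sqrt mgF mk
  have e1 : ∫ x, ‖gF x‖ ^ 2 = ∫ x, frobeniusNormSq (fderiv ℝ h x) :=
    integral_congr_ae (Eventually.of_forall fun x => by
      dsimp only; rw [Real.norm_of_nonneg (hgF0 x), hgFsq])
  rw [e1] at hcs
  -- the pointwise bound
  have hpt : ∀ x, ⟪convect f h x, k x⟫ ≤ M * (‖gF x‖ * ‖k x‖) := by
    intro x
    calc ⟪convect f h x, k x⟫ ≤ ‖convect f h x‖ * ‖k x‖ := real_inner_le_norm _ _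
      _ ≤ (‖f x‖ * gF x) * ‖k x‖ :=
          mul_le_mul_of_nonneg_right (norm_convect_le_mul_sqrt_frobeniusNormSq f h x) (norm_nonneg _)
      _ ≤ (M * gF x) * ‖k x‖ :=
          mul_le_mul_of_nonneg_right (mul_le_mul_of_nonneg_right (hM x) (hgF0 x)) (norm_nonneg _)
      _ = M * (‖gF x‖ * ‖k x‖) := by rw [Real.norm_of_nonneg (hgF0 x)]; ring
  have hrhs0 : 0 ≤ M * Real.sqrt (∫ x, frobeniusNormSq (fderiv ℝ h x)) *
      Real.sqrt (∫ x, ‖k x‖ ^ 2) := by positivity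
  by_cases hint : Integrable (fun x => ⟪convect f h x, k x⟫) volume
  · have hint2 : Integrable (fun x => M * (‖gF x‖ * ‖k x‖)) volume := by
      refine Integrable.const_mul ?_ M
      exact integrable_of_norm_le_mul_of_lintegral_sq
        ((cgF.norm.mul hk.norm).aestronglyMeasurable) cgF hk hgF2 hk0
        (fun x => by rw [Real.norm_of_nonneg (mul_nonneg (norm_nonneg _) (norm_nonneg _))])
    calc ∫ x, ⟪convect f h x, k x⟫ ≤ ∫ x, M * (‖gF x‖ * ‖k x‖) := integral_mono hint hint2 hpt
      _ = M * ∫ x, ‖gF x‖ * ‖k x‖ := integral_const_mul _ _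
      _ ≤ M * (Real.sqrt (∫ x, frobeniusNormSq (fderiv ℝ h x)) * Real.sqrt (∫ x, ‖k x‖ ^ 2)) :=
          mul_le_mul_of_nonneg_left hcs hM0
      _ = M * Real.sqrt (∫ x, frobeniusNormSq (fderiv ℝ h x)) * Real.sqrt (∫ x, ‖k x‖ ^ 2) := by
          ring
  · rw [integral_undef hint]
    exact hrhs0


/-- Linear algebra on `ℝ³`: `Σₖ ⟪B eₖ, B (A eₖ)⟫ = Σⱼ ⟪B†eⱼ, A (B†eⱼ)⟫` (both are the trace
`tr(B†BA) = tr(BAB†)`). [folklore] -/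
private theorem r3rob_sum_inner_comp_eq
    (A B : EuclideanSpace ℝ (Fin 3) →L[ℝ] EuclideanSpace ℝ (Fin 3)) :
    ∑ k, ⟪B (EuclideanSpace.basisFun (Fin 3) ℝ k), B (A (EuclideanSpace.basisFun (Fin 3) ℝ k))⟫ =
      ∑ j, ⟪(ContinuousLinearMap.adjoint B) (EuclideanSpace.basisFun (Fin 3) ℝ j),
        A ((ContinuousLinearMap.adjoint B) (EuclideanSpace.basisFun (Fin 3) ℝ j))⟫ := by
  set e := EuclideanSpace.basisFun (Fin 3) ℝ with he
  set Bd := ContinuousLinearMap.adjoint B with hBd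
  have h1 : ∑ k, ⟪B (e k), B (A (e k))⟫ =
      LinearMap.trace ℝ (EuclideanSpace ℝ (Fin 3))
        ((Bd : EuclideanSpace ℝ (Fin 3) →ₗ[ℝ] EuclideanSpace ℝ (Fin 3)) ∘ₗ
          ((B : EuclideanSpace ℝ (Fin 3) →ₗ[ℝ] EuclideanSpace ℝ (Fin 3)) ∘ₗ
            (A : EuclideanSpace ℝ (Fin 3) →ₗ[ℝ] EuclideanSpace ℝ (Fin 3)))) := by
    rw [LinearMap.trace_eq_sum_inner _ e]
    refine Finset.sum_congr rfl fun k _ => ?_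
    simp only [LinearMap.coe_comp, Function.comp_apply, ContinuousLinearMap.coe_coe]
    rw [hBd, ContinuousLinearMap.adjoint_inner_right]
  have h2 : ∑ j, ⟪Bd (e j), A (Bd (e j))⟫ =
      LinearMap.trace ℝ (EuclideanSpace ℝ (Fin 3))
        (((B : EuclideanSpace ℝ (Fin 3) →ₗ[ℝ] EuclideanSpace ℝ (Fin 3)) ∘ₗ
            (A : EuclideanSpace ℝ (Fin 3) →ₗ[ℝ] EuclideanSpace ℝ (Fin 3))) ∘ₗ
          (Bd : EuclideanSpace ℝ (Fin 3) →ₗ[ℝ] EuclideanSpace ℝ (Fin 3))) := by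
    rw [LinearMap.trace_eq_sum_inner _ e]
    refine Finset.sum_congr rfl fun j _ => ?_
    simp only [LinearMap.coe_comp, Function.comp_apply, ContinuousLinearMap.coe_coe]
    rw [hBd, ContinuousLinearMap.adjoint_inner_left]
  rw [h1, h2, LinearMap.trace_comp_comm']

/-- `frobeniusNormSq B† = frobeniusNormSq B` on `ℝ³` (Parseval twice). [folklore] -/
private theorem r3rob_frobeniusNormSq_adjoint
    (B : EuclideanSpace ℝ (Fin 3) →L[ℝ] EuclideanSpace ℝ (Fin 3)) :
    frobeniusNormSq (ContinuousLinearMap.adjoint B) = frobeniusNormSq B := by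
  set e := EuclideanSpace.basisFun (Fin 3) ℝ with he
  have hsq : ∀ x : EuclideanSpace ℝ (Fin 3), ‖x‖ ^ 2 = ∑ k, ⟪x, e k⟫ ^ 2 := fun x => by
    rw [EuclideanSpace.real_norm_sq_eq]
    refine Finset.sum_congr rfl fun k _ => ?_
    rw [he, EuclideanSpace.basisFun_apply, EuclideanSpace.inner_single_right]
    simp
  rw [frobeniusNormSq_eq_sum e, frobeniusNormSq_eq_sum e]
  simp_rw [hsq]
  rw [Finset.sum_comm]
  refine Finset.sum_congr rfl fun k _ => Finset.sum_congr rfl fun j _ => ?_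
  rw [ContinuousLinearMap.adjoint_inner_left, real_inner_comm]

/-- The first quadratic form: `−Σₖ ⟪B eₖ, B (A eₖ)⟫ ≤ G |B|²_F` if `−⟪Aξ, ξ⟫ ≤ G‖ξ‖²` for all `ξ`
(`A = Du`, `B = Dw`: the form `−Σᵢ ⟪∇wᵢ, Du ∇wᵢ⟫` of the transport term after integration by
parts). [folklore] -/
private theorem r3rob_neg_sum_inner_comp_le
    (A B : EuclideanSpace ℝ (Fin 3) →L[ℝ] EuclideanSpace ℝ (Fin 3)) {G : ℝ}
    (hG : ∀ ξ : EuclideanSpace ℝ (Fin 3), -⟪A ξ, ξ⟫ ≤ G * ‖ξ‖ ^ 2) :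
    -∑ k, ⟪B (EuclideanSpace.basisFun (Fin 3) ℝ k), B (A (EuclideanSpace.basisFun (Fin 3) ℝ k))⟫ ≤
      G * frobeniusNormSq B := by
  set e := EuclideanSpace.basisFun (Fin 3) ℝ with he
  set Bd := ContinuousLinearMap.adjoint B with hBd
  rw [r3rob_sum_inner_comp_eq A B, ← r3rob_frobeniusNormSq_adjoint B, frobeniusNormSq_eq_sum e,
    Finset.mul_sum, ← Finset.sum_neg_distrib]
  refine Finset.sum_le_sum fun j _ => ?_
  rw [real_inner_comm]
  exact hG _

/-- The second quadratic form: `−Σₖ ⟪B eₖ, A (B eₖ)⟫ ≤ G |B|²_F` if `−⟪Aξ, ξ⟫ ≤ G‖ξ‖²` (the form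
`−Σₖ ⟪∂ₖw, Du ∂ₖw⟫` of the stretching term). [folklore] -/
private theorem r3rob_neg_sum_inner_le
    (A B : EuclideanSpace ℝ (Fin 3) →L[ℝ] EuclideanSpace ℝ (Fin 3)) {G : ℝ}
    (hG : ∀ ξ : EuclideanSpace ℝ (Fin 3), -⟪A ξ, ξ⟫ ≤ G * ‖ξ‖ ^ 2) :
    -∑ k, ⟪B (EuclideanSpace.basisFun (Fin 3) ℝ k), A (B (EuclideanSpace.basisFun (Fin 3) ℝ k))⟫ ≤
      G * frobeniusNormSq B := by
  set e := EuclideanSpace.basisFun (Fin 3) ℝ with he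
  rw [frobeniusNormSq_eq_sum e, Finset.mul_sum, ← Finset.sum_neg_distrib]
  refine Finset.sum_le_sum fun k _ => ?_
  rw [real_inner_comm]
  exact hG _

variable {u w : EuclideanSpace ℝ (Fin 3) → EuclideanSpace ℝ (Fin 3)}

/-- **The product rule for the convective term** on `ℝ³` (smooth fields):
`∂ₑ((a·∇)b) = Db(∂ₑa) + (a·∇)(∂ₑb)` (the tree's `fderiv_convect_apply_eqOn` on `univ`). [folklore] -/
private theorem fderiv_convect_apply_of_contDiff
    {a b : EuclideanSpace ℝ (Fin 3) → EuclideanSpace ℝ (Fin 3)} (ha : ContDiff ℝ ∞ a)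
    (hb : ContDiff ℝ ∞ b)
    (x ξ : EuclideanSpace ℝ (Fin 3)) :
    fderiv ℝ (convect a b) x ξ =
      fderiv ℝ b x (fderiv ℝ a x ξ) + convect a (fun y => fderiv ℝ b y ξ) x := by
  have h := fderiv_convect_apply_eqOn isOpen_univ ha.contDiffOn hb.contDiffOn ξ (mem_univ x)
  simpa [convect] using h

/-- **The transport trilinear term, integrated by parts** (cstrat-19179's (I1); Beirão da Veiga /
Berselli–Galdi's `∫Δu·(u·∇)u = −Σ∂ₖuⱼ∂ⱼuᵢ∂ₖuᵢ` with two different fields): for `C^∞` fields `u, w`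
on `ℝ³` with `div u = 0`, `u, Du` bounded and `Dw, D²w ∈ L²`,
`∫ ⟪Δw, (u·∇)w⟫ = −Σᵢ ∫ ⟪∂ᵢw, Dw(∂ᵢu)⟫` — the transport term `∫⟪∂ᵢw, (u·∇)∂ᵢw⟫` vanishes
(`integral_inner_convect_transport_eq_zero`). [folklore] -/
private theorem integral_inner_laplacian_convect_left_eq_neg_sum (hu : ContDiff ℝ ∞ u) (hw : ContDiff ℝ ∞ w)
    (hdiv : VectorCalculus.IsDivFree u) {B : ℝ} (hB : ∀ x, ‖u x‖ ≤ B)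
    {B₁ : ℝ} (hB₁ : ∀ x, ‖fderiv ℝ u x‖ ≤ B₁)
    (hw1 : ∫⁻ x, ‖iteratedFDeriv ℝ 1 w x‖ₑ ^ 2 < ⊤) (hw2 : ∫⁻ x, ‖iteratedFDeriv ℝ 2 w x‖ₑ ^ 2 < ⊤) :
    (Integrable (fun x => ∑ i, ⟪fderiv ℝ w x (EuclideanSpace.basisFun (Fin 3) ℝ i),
        fderiv ℝ w x (fderiv ℝ u x (EuclideanSpace.basisFun (Fin 3) ℝ i))⟫) volume) ∧
    ∫ x, ⟪(Δ w) x, convect u w x⟫ =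
      - ∫ x, ∑ i, ⟪fderiv ℝ w x (EuclideanSpace.basisFun (Fin 3) ℝ i),
          fderiv ℝ w x (fderiv ℝ u x (EuclideanSpace.basisFun (Fin 3) ℝ i))⟫ := by
  set e := EuclideanSpace.basisFun (Fin 3) ℝ with he
  have he1 : ∀ i, ‖e i‖ = 1 := fun i => by simp [he]
  have hB0 : 0 ≤ B := (norm_nonneg _).trans (hB 0)
  have hB₁0 : 0 ≤ B₁ := (norm_nonneg _).trans (hB₁ 0)
  have hw2' : ContDiff ℝ 2 w := hw.of_le (by norm_cast)
  have hw1' : ContDiff ℝ 1 w := hw.of_le (by norm_cast)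
  have hu1' : ContDiff ℝ 1 u := hu.of_le (by norm_cast)
  obtain ⟨F, hFdef⟩ : ∃ F : EuclideanSpace ℝ (Fin 3) → EuclideanSpace ℝ (Fin 3),
      F = convect u w := ⟨_, rfl⟩
  have hF : ContDiff ℝ 1 F := by
    rw [hFdef]; exact (hw.fderiv_right (m := 1) (by norm_cast)).clm_apply hu1'
  -- slices
  obtain ⟨ws, hws⟩ : ∃ ws : Fin 3 → EuclideanSpace ℝ (Fin 3) → EuclideanSpace ℝ (Fin 3),
      ws = fun i y => fderiv ℝ w y (e i) := ⟨_, rfl⟩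
  have hws2 : ∀ i, ContDiff ℝ 2 (ws i) := fun i => by
    rw [hws]; exact (hw.fderiv_right (m := 2) (by norm_cast)).clm_apply contDiff_const
  have hws1 : ∀ i, ContDiff ℝ 1 (ws i) := fun i => (hws2 i).of_le (by norm_num)
  have hwsinf : ∀ i, ContDiff ℝ ∞ (ws i) := fun i => by
    rw [hws]; exact (hw.fderiv_right (m := ∞) (by norm_cast)).clm_apply contDiff_const
  -- continuity
  have cu : Continuous u := hu.continuous
  have cDu : Continuous (fderiv ℝ u) := hu1'.continuous_fderiv one_ne_zero
  have cDw : Continuous (fderiv ℝ w) := hw1'.continuous_fderiv one_ne_zero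
  have cws : ∀ i, Continuous (ws i) := fun i => (hws1 i).continuous
  have cDws : ∀ i, Continuous (fderiv ℝ (ws i)) := fun i => (hws1 i).continuous_fderiv one_ne_zero
  have cddw : ∀ i, Continuous fun x => fderiv ℝ (ws i) x (e i) := fun i =>
    (cDws i).clm_apply continuous_const
  have cF : Continuous F := by rw [hFdef]; exact cDw.clm_apply cu
  have cDF : Continuous (fderiv ℝ F) := hF.continuous_fderiv one_ne_zero
  -- pointwise norm bounds
  have hDw_eq : ∀ x, ‖fderiv ℝ w x‖ = ‖iteratedFDeriv ℝ 1 w x‖ := fun x => by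
    rw [← norm_iteratedFDeriv_fderiv, norm_iteratedFDeriv_zero]
  have n_ws : ∀ i x, ‖ws i x‖ ≤ ‖fderiv ℝ w x‖ := fun i x => by
    rw [hws]; simpa [he1] using (fderiv ℝ w x).le_opNorm (e i)
  have n_Dws : ∀ i x, ‖fderiv ℝ (ws i) x‖ ≤ ‖iteratedFDeriv ℝ 2 w x‖ := fun i x => by
    have h : ‖fderiv ℝ (ws i) x‖ = ‖iteratedFDeriv ℝ 1 (ws i) x‖ := by
      rw [← norm_iteratedFDeriv_fderiv, norm_iteratedFDeriv_zero]
    rw [h, hws]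
    exact norm_iteratedFDeriv_fderiv_apply_basisFun_le hw 1 (by norm_cast) x i
  have n_ddw : ∀ i x, ‖fderiv ℝ (ws i) x (e i)‖ ≤ ‖iteratedFDeriv ℝ 2 w x‖ := fun i x => by
    have h1 : ‖fderiv ℝ (ws i) x (e i)‖ ≤ ‖fderiv ℝ (ws i) x‖ := by
      simpa [he1] using (fderiv ℝ (ws i) x).le_opNorm (e i)
    exact h1.trans (n_Dws i x)
  have n_F : ∀ x, ‖F x‖ ≤ ‖B * ‖fderiv ℝ w x‖‖ := fun x => by
    rw [hFdef, convect, Real.norm_of_nonneg (mul_nonneg hB0 (norm_nonneg _)), mul_comm]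
    exact (fderiv ℝ w x).le_opNorm_of_le (hB x)
  -- finite `L²` norms
  have l2Dw : ∫⁻ x, ‖fderiv ℝ w x‖ₑ ^ 2 < ⊤ :=
    lintegral_enorm_sq_lt_top_of_norm_le (fun x => (hDw_eq x).le) hw1
  have l2ws : ∀ i, ∫⁻ x, ‖ws i x‖ₑ ^ 2 < ⊤ := fun i => lintegral_enorm_sq_lt_top_of_norm_le (n_ws i) l2Dw
  have l2Dws : ∀ i, ∫⁻ x, ‖fderiv ℝ (ws i) x‖ₑ ^ 2 < ⊤ := fun i =>
    lintegral_enorm_sq_lt_top_of_norm_le (n_Dws i) hw2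
  have l2ddw : ∀ i, ∫⁻ x, ‖fderiv ℝ (ws i) x (e i)‖ₑ ^ 2 < ⊤ := fun i =>
    lintegral_enorm_sq_lt_top_of_norm_le (n_ddw i) hw2
  have l2F : ∫⁻ x, ‖F x‖ₑ ^ 2 < ⊤ :=
    lintegral_enorm_sq_lt_top_of_norm_le n_F (r3rob_lintegral_sq_mul_norm_lt_top B l2Dw)
  -- the derivative of `F`: `∂ᵢF = Dw(∂ᵢu) + (u·∇)(∂ᵢw)`
  have hdF : ∀ i x, fderiv ℝ F x (e i) = fderiv ℝ w x (fderiv ℝ u x (e i)) + convect u (ws i) x := by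
    intro i x
    rw [hFdef, fderiv_convect_apply_of_contDiff hu hw x (e i), hws]
  -- the two pieces of `⟪wsᵢ, ∂ᵢF⟫` and their integrability
  have n_a : ∀ i x, ‖fderiv ℝ w x (fderiv ℝ u x (e i))‖ ≤ ‖B₁ * ‖fderiv ℝ w x‖‖ := fun i x => by
    rw [Real.norm_of_nonneg (mul_nonneg hB₁0 (norm_nonneg _)), mul_comm]
    refine (fderiv ℝ w x).le_opNorm_of_le ?_
    calc ‖fderiv ℝ u x (e i)‖ ≤ ‖fderiv ℝ u x‖ * ‖e i‖ := (fderiv ℝ u x).le_opNorm _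
      _ ≤ B₁ := by rw [he1, mul_one]; exact hB₁ x
  have n_b : ∀ i x, ‖convect u (ws i) x‖ ≤ ‖B * ‖fderiv ℝ (ws i) x‖‖ := fun i x => by
    rw [convect, Real.norm_of_nonneg (mul_nonneg hB0 (norm_nonneg _)), mul_comm]
    exact (fderiv ℝ (ws i) x).le_opNorm_of_le (hB x)
  have ca : ∀ i, Continuous fun x => fderiv ℝ w x (fderiv ℝ u x (e i)) := fun i =>
    cDw.clm_apply (cDu.clm_apply continuous_const)
  have cb : ∀ i, Continuous (convect u (ws i)) := fun i => (cDws i).clm_apply cu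
  have l2a : ∀ i, ∫⁻ x, ‖fderiv ℝ w x (fderiv ℝ u x (e i))‖ₑ ^ 2 < ⊤ := fun i =>
    lintegral_enorm_sq_lt_top_of_norm_le (n_a i) (r3rob_lintegral_sq_mul_norm_lt_top B₁ l2Dw)
  have l2b : ∀ i, ∫⁻ x, ‖convect u (ws i) x‖ₑ ^ 2 < ⊤ := fun i =>
    lintegral_enorm_sq_lt_top_of_norm_le (n_b i) (r3rob_lintegral_sq_mul_norm_lt_top B (l2Dws i))
  have i2a : ∀ i, Integrable (fun x => ⟪ws i x, fderiv ℝ w x (fderiv ℝ u x (e i))⟫) volume := fun i =>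
    integrable_of_norm_le_mul_of_lintegral_sq ((cws i).inner (ca i)).aestronglyMeasurable (cws i) (ca i)
      (l2ws i) (l2a i) fun x => norm_inner_le_norm _ _
  have i2b : ∀ i, Integrable (fun x => ⟪ws i x, convect u (ws i) x⟫) volume := fun i =>
    integrable_of_norm_le_mul_of_lintegral_sq ((cws i).inner (cb i)).aestronglyMeasurable (cws i) (cb i)
      (l2ws i) (l2b i) fun x => norm_inner_le_norm _ _
  -- integrability for the integration by parts
  have i1 : ∀ i, Integrable (fun x => ⟪fderiv ℝ (fun y => fderiv ℝ w y (e i)) x (e i), F x⟫)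
      volume := fun i => by
    have h : Integrable (fun x => ⟪fderiv ℝ (ws i) x (e i), F x⟫) volume :=
      integrable_of_norm_le_mul_of_lintegral_sq ((cddw i).inner cF).aestronglyMeasurable (cddw i)
        cF (l2ddw i) l2F fun x => norm_inner_le_norm _ _
    rw [hws] at h
    exact h
  have i2 : ∀ i, Integrable (fun x => ⟪fderiv ℝ w x (e i), fderiv ℝ F x (e i)⟫) volume := fun i => by
    have h := (i2a i).add (i2b i)
    refine h.congr (Eventually.of_forall fun x => ?_)
    simp only [Pi.add_apply, hdF i x, inner_add_right, hws]
  have i3 : ∀ i, Integrable (fun x => ⟪fderiv ℝ w x (e i), F x⟫) volume := fun i => by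
    have h : Integrable (fun x => ⟪ws i x, F x⟫) volume :=
      integrable_of_norm_le_mul_of_lintegral_sq ((cws i).inner cF).aestronglyMeasurable (cws i)
        cF (l2ws i) l2F fun x => norm_inner_le_norm _ _
    rw [hws] at h
    exact h
  -- integration by parts
  have hL := integral_sum_inner_fderiv_fderiv_eq_neg_integral_inner_laplacian hw2' hF i1 i2 i3
  -- the transport terms vanish
  have htr : ∀ i, ∫ x, ⟪ws i x, convect u (ws i) x⟫ = 0 := by
    intro i
    have hswap : (fun x => ⟪ws i x, convect u (ws i) x⟫) = fun x => ⟪convect u (ws i) x, ws i x⟫ :=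
      funext fun x => real_inner_comm _ _
    rw [hswap]
    exact integral_inner_convect_transport_eq_zero hu1' hdiv hB (hws1 i)
      (r3rob_memLp_two (cws i) (l2ws i)) (r3rob_memLp_two (cDws i) (l2Dws i))
  have hsplit : ∀ i, ∫ x, ⟪fderiv ℝ w x (e i), fderiv ℝ F x (e i)⟫ =
      ∫ x, ⟪ws i x, fderiv ℝ w x (fderiv ℝ u x (e i))⟫ := by
    intro i
    have h1 : (fun x => ⟪fderiv ℝ w x (e i), fderiv ℝ F x (e i)⟫) =
        fun x => ⟪ws i x, fderiv ℝ w x (fderiv ℝ u x (e i))⟫ + ⟪ws i x, convect u (ws i) x⟫ :=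
      funext fun x => by rw [hdF i x, inner_add_right, hws]
    rw [h1, integral_add (i2a i) (i2b i), htr i, add_zero]
  have hL' : ∫ x, ⟪(Δ w) x, F x⟫ = - ∫ x, ∑ i, ⟪fderiv ℝ w x (e i), fderiv ℝ F x (e i)⟫ := by
    rw [hL, neg_neg]
  have i2a' : ∀ i, Integrable (fun x => ⟪fderiv ℝ w x (e i), fderiv ℝ w x (fderiv ℝ u x (e i))⟫)
      volume := fun i => by
    have h := i2a i
    rw [hws] at h
    exact h
  refine ⟨integrable_finsetSum _ fun i _ => i2a' i, ?_⟩
  rw [← hFdef, hL', integral_finsetSum _ fun i _ => i2 i, Finset.sum_congr rfl fun i _ => hsplit i,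
    ← integral_finsetSum _ fun i _ => i2a i, hws]

/-- **The stretching trilinear term, integrated by parts** (cstrat-19179's (I2)): for `C^∞` fields
`u, w` on `ℝ³` with `Du, D²u` bounded and `w, Dw, D²w ∈ L²`,
`∫ ⟪Δw, (w·∇)u⟫ = −Σᵢ ∫ ⟪∂ᵢw, Du(∂ᵢw)⟫ − Σᵢ ∫ ⟪∂ᵢw, (w·∇)∂ᵢu⟫`. [folklore] -/
private theorem integral_inner_laplacian_convect_right_eq_neg_sum (hu : ContDiff ℝ ∞ u) (hw : ContDiff ℝ ∞ w)
    {B₁ : ℝ} (hB₁ : ∀ x, ‖fderiv ℝ u x‖ ≤ B₁) {B₂ : ℝ} (hB₂ : ∀ x, ‖iteratedFDeriv ℝ 2 u x‖ ≤ B₂)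
    (hw0 : ∫⁻ x, ‖w x‖ₑ ^ 2 < ⊤)
    (hw1 : ∫⁻ x, ‖iteratedFDeriv ℝ 1 w x‖ₑ ^ 2 < ⊤) (hw2 : ∫⁻ x, ‖iteratedFDeriv ℝ 2 w x‖ₑ ^ 2 < ⊤) :
    (Integrable (fun x => ∑ i, ⟪fderiv ℝ w x (EuclideanSpace.basisFun (Fin 3) ℝ i),
        fderiv ℝ u x (fderiv ℝ w x (EuclideanSpace.basisFun (Fin 3) ℝ i))⟫) volume) ∧
    (Integrable (fun x => ∑ i, ⟪fderiv ℝ w x (EuclideanSpace.basisFun (Fin 3) ℝ i),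
        convect w (fun y => fderiv ℝ u y (EuclideanSpace.basisFun (Fin 3) ℝ i)) x⟫) volume) ∧
    ∫ x, ⟪(Δ w) x, convect w u x⟫ =
      - (∫ x, ∑ i, ⟪fderiv ℝ w x (EuclideanSpace.basisFun (Fin 3) ℝ i),
          fderiv ℝ u x (fderiv ℝ w x (EuclideanSpace.basisFun (Fin 3) ℝ i))⟫)
      - ∫ x, ∑ i, ⟪fderiv ℝ w x (EuclideanSpace.basisFun (Fin 3) ℝ i),
          convect w (fun y => fderiv ℝ u y (EuclideanSpace.basisFun (Fin 3) ℝ i)) x⟫ := by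
  set e := EuclideanSpace.basisFun (Fin 3) ℝ with he
  have he1 : ∀ i, ‖e i‖ = 1 := fun i => by simp [he]
  have hB₁0 : 0 ≤ B₁ := (norm_nonneg _).trans (hB₁ 0)
  have hB₂0 : 0 ≤ B₂ := (norm_nonneg _).trans (hB₂ 0)
  have hw2' : ContDiff ℝ 2 w := hw.of_le (by norm_cast)
  have hw1' : ContDiff ℝ 1 w := hw.of_le (by norm_cast)
  have hu1' : ContDiff ℝ 1 u := hu.of_le (by norm_cast)
  have hu2' : ContDiff ℝ 2 u := hu.of_le (by norm_cast)
  obtain ⟨F, hFdef⟩ : ∃ F : EuclideanSpace ℝ (Fin 3) → EuclideanSpace ℝ (Fin 3),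
      F = convect w u := ⟨_, rfl⟩
  have hF : ContDiff ℝ 1 F := by
    rw [hFdef]; exact (hu.fderiv_right (m := 1) (by norm_cast)).clm_apply hw1'
  -- slices
  obtain ⟨ws, hws⟩ : ∃ ws : Fin 3 → EuclideanSpace ℝ (Fin 3) → EuclideanSpace ℝ (Fin 3),
      ws = fun i y => fderiv ℝ w y (e i) := ⟨_, rfl⟩
  obtain ⟨us, hus⟩ : ∃ us : Fin 3 → EuclideanSpace ℝ (Fin 3) → EuclideanSpace ℝ (Fin 3),
      us = fun i y => fderiv ℝ u y (e i) := ⟨_, rfl⟩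
  have hws2 : ∀ i, ContDiff ℝ 2 (ws i) := fun i => by
    rw [hws]; exact (hw.fderiv_right (m := 2) (by norm_cast)).clm_apply contDiff_const
  have hws1 : ∀ i, ContDiff ℝ 1 (ws i) := fun i => (hws2 i).of_le (by norm_num)
  have hus1 : ∀ i, ContDiff ℝ 1 (us i) := fun i => by
    rw [hus]; exact (hu.fderiv_right (m := 1) (by norm_cast)).clm_apply contDiff_const
  -- continuity
  have cu : Continuous u := hu.continuous
  have cw : Continuous w := hw.continuous
  have cDu : Continuous (fderiv ℝ u) := hu1'.continuous_fderiv one_ne_zero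
  have cDw : Continuous (fderiv ℝ w) := hw1'.continuous_fderiv one_ne_zero
  have cws : ∀ i, Continuous (ws i) := fun i => (hws1 i).continuous
  have cDws : ∀ i, Continuous (fderiv ℝ (ws i)) := fun i => (hws1 i).continuous_fderiv one_ne_zero
  have cDus : ∀ i, Continuous (fderiv ℝ (us i)) := fun i => (hus1 i).continuous_fderiv one_ne_zero
  have cddw : ∀ i, Continuous fun x => fderiv ℝ (ws i) x (e i) := fun i =>
    (cDws i).clm_apply continuous_const
  have cF : Continuous F := by rw [hFdef]; exact cDu.clm_apply cw
  -- pointwise norm bounds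
  have hDw_eq : ∀ x, ‖fderiv ℝ w x‖ = ‖iteratedFDeriv ℝ 1 w x‖ := fun x => by
    rw [← norm_iteratedFDeriv_fderiv, norm_iteratedFDeriv_zero]
  have n_ws : ∀ i x, ‖ws i x‖ ≤ ‖fderiv ℝ w x‖ := fun i x => by
    rw [hws]; simpa [he1] using (fderiv ℝ w x).le_opNorm (e i)
  have n_Dws : ∀ i x, ‖fderiv ℝ (ws i) x‖ ≤ ‖iteratedFDeriv ℝ 2 w x‖ := fun i x => by
    have h : ‖fderiv ℝ (ws i) x‖ = ‖iteratedFDeriv ℝ 1 (ws i) x‖ := by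
      rw [← norm_iteratedFDeriv_fderiv, norm_iteratedFDeriv_zero]
    rw [h, hws]
    exact norm_iteratedFDeriv_fderiv_apply_basisFun_le hw 1 (by norm_cast) x i
  have n_ddw : ∀ i x, ‖fderiv ℝ (ws i) x (e i)‖ ≤ ‖iteratedFDeriv ℝ 2 w x‖ := fun i x => by
    have h1 : ‖fderiv ℝ (ws i) x (e i)‖ ≤ ‖fderiv ℝ (ws i) x‖ := by
      simpa [he1] using (fderiv ℝ (ws i) x).le_opNorm (e i)
    exact h1.trans (n_Dws i x)
  have n_Dus : ∀ i x, ‖fderiv ℝ (us i) x‖ ≤ B₂ := fun i x => by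
    have h : ‖fderiv ℝ (us i) x‖ = ‖iteratedFDeriv ℝ 1 (us i) x‖ := by
      rw [← norm_iteratedFDeriv_fderiv, norm_iteratedFDeriv_zero]
    rw [h, hus]
    exact (norm_iteratedFDeriv_fderiv_apply_basisFun_le hu 1 (by norm_cast) x i).trans (hB₂ x)
  have n_F : ∀ x, ‖F x‖ ≤ ‖B₁ * ‖w x‖‖ := fun x => by
    rw [hFdef, convect, Real.norm_of_nonneg (mul_nonneg hB₁0 (norm_nonneg _))]
    exact (fderiv ℝ u x).le_of_opNorm_le (hB₁ x) (w x)
  -- finite `L²` norms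
  have l2Dw : ∫⁻ x, ‖fderiv ℝ w x‖ₑ ^ 2 < ⊤ :=
    lintegral_enorm_sq_lt_top_of_norm_le (fun x => (hDw_eq x).le) hw1
  have l2ws : ∀ i, ∫⁻ x, ‖ws i x‖ₑ ^ 2 < ⊤ := fun i => lintegral_enorm_sq_lt_top_of_norm_le (n_ws i) l2Dw
  have l2Dws : ∀ i, ∫⁻ x, ‖fderiv ℝ (ws i) x‖ₑ ^ 2 < ⊤ := fun i =>
    lintegral_enorm_sq_lt_top_of_norm_le (n_Dws i) hw2
  have l2ddw : ∀ i, ∫⁻ x, ‖fderiv ℝ (ws i) x (e i)‖ₑ ^ 2 < ⊤ := fun i =>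
    lintegral_enorm_sq_lt_top_of_norm_le (n_ddw i) hw2
  have l2F : ∫⁻ x, ‖F x‖ₑ ^ 2 < ⊤ :=
    lintegral_enorm_sq_lt_top_of_norm_le n_F (r3rob_lintegral_sq_mul_norm_lt_top B₁ hw0)
  -- the derivative of `F`: `∂ᵢF = Du(∂ᵢw) + (w·∇)(∂ᵢu)`
  have hdF : ∀ i x, fderiv ℝ F x (e i) = fderiv ℝ u x (ws i x) + convect w (us i) x := by
    intro i x
    rw [hFdef, fderiv_convect_apply_of_contDiff hw hu x (e i), hws, hus]
  -- the two pieces and their integrability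
  have n_a : ∀ i x, ‖fderiv ℝ u x (ws i x)‖ ≤ ‖B₁ * ‖fderiv ℝ w x‖‖ := fun i x => by
    rw [Real.norm_of_nonneg (mul_nonneg hB₁0 (norm_nonneg _))]
    exact ((fderiv ℝ u x).le_of_opNorm_le (hB₁ x) (ws i x)).trans
      (mul_le_mul_of_nonneg_left (n_ws i x) hB₁0)
  have n_b : ∀ i x, ‖convect w (us i) x‖ ≤ ‖B₂ * ‖w x‖‖ := fun i x => by
    rw [convect, Real.norm_of_nonneg (mul_nonneg hB₂0 (norm_nonneg _))]
    exact (fderiv ℝ (us i) x).le_of_opNorm_le (n_Dus i x) (w x)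
  have ca : ∀ i, Continuous fun x => fderiv ℝ u x (ws i x) := fun i => cDu.clm_apply (cws i)
  have cb : ∀ i, Continuous (convect w (us i)) := fun i => (cDus i).clm_apply cw
  have l2a : ∀ i, ∫⁻ x, ‖fderiv ℝ u x (ws i x)‖ₑ ^ 2 < ⊤ := fun i =>
    lintegral_enorm_sq_lt_top_of_norm_le (n_a i) (r3rob_lintegral_sq_mul_norm_lt_top B₁ l2Dw)
  have l2b : ∀ i, ∫⁻ x, ‖convect w (us i) x‖ₑ ^ 2 < ⊤ := fun i =>
    lintegral_enorm_sq_lt_top_of_norm_le (n_b i) (r3rob_lintegral_sq_mul_norm_lt_top B₂ hw0)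
  have i2a : ∀ i, Integrable (fun x => ⟪ws i x, fderiv ℝ u x (ws i x)⟫) volume := fun i =>
    integrable_of_norm_le_mul_of_lintegral_sq ((cws i).inner (ca i)).aestronglyMeasurable (cws i) (ca i)
      (l2ws i) (l2a i) fun x => norm_inner_le_norm _ _
  have i2b : ∀ i, Integrable (fun x => ⟪ws i x, convect w (us i) x⟫) volume := fun i =>
    integrable_of_norm_le_mul_of_lintegral_sq ((cws i).inner (cb i)).aestronglyMeasurable (cws i) (cb i)
      (l2ws i) (l2b i) fun x => norm_inner_le_norm _ _
  -- integrability for the integration by parts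
  have i1 : ∀ i, Integrable (fun x => ⟪fderiv ℝ (fun y => fderiv ℝ w y (e i)) x (e i), F x⟫)
      volume := fun i => by
    have h : Integrable (fun x => ⟪fderiv ℝ (ws i) x (e i), F x⟫) volume :=
      integrable_of_norm_le_mul_of_lintegral_sq ((cddw i).inner cF).aestronglyMeasurable (cddw i)
        cF (l2ddw i) l2F fun x => norm_inner_le_norm _ _
    rw [hws] at h
    exact h
  have i2 : ∀ i, Integrable (fun x => ⟪fderiv ℝ w x (e i), fderiv ℝ F x (e i)⟫) volume := fun i => by
    have h := (i2a i).add (i2b i)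
    refine h.congr (Eventually.of_forall fun x => ?_)
    simp only [Pi.add_apply, hdF i x, inner_add_right, hws]
  have i3 : ∀ i, Integrable (fun x => ⟪fderiv ℝ w x (e i), F x⟫) volume := fun i => by
    have h : Integrable (fun x => ⟪ws i x, F x⟫) volume :=
      integrable_of_norm_le_mul_of_lintegral_sq ((cws i).inner cF).aestronglyMeasurable (cws i)
        cF (l2ws i) l2F fun x => norm_inner_le_norm _ _
    rw [hws] at h
    exact h
  -- integration by parts
  have hL := integral_sum_inner_fderiv_fderiv_eq_neg_integral_inner_laplacian hw2' hF i1 i2 i3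
  have hsplit : ∀ i, ∫ x, ⟪fderiv ℝ w x (e i), fderiv ℝ F x (e i)⟫ =
      (∫ x, ⟪ws i x, fderiv ℝ u x (ws i x)⟫) + ∫ x, ⟪ws i x, convect w (us i) x⟫ := by
    intro i
    have h1 : (fun x => ⟪fderiv ℝ w x (e i), fderiv ℝ F x (e i)⟫) =
        fun x => ⟪ws i x, fderiv ℝ u x (ws i x)⟫ + ⟪ws i x, convect w (us i) x⟫ :=
      funext fun x => by rw [hdF i x, inner_add_right, hws]
    rw [h1, integral_add (i2a i) (i2b i)]
  have hL' : ∫ x, ⟪(Δ w) x, F x⟫ = - ∫ x, ∑ i, ⟪fderiv ℝ w x (e i), fderiv ℝ F x (e i)⟫ := by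
    rw [hL, neg_neg]
  have i2a' : ∀ i, Integrable (fun x => ⟪fderiv ℝ w x (e i), fderiv ℝ u x (fderiv ℝ w x (e i))⟫)
      volume := fun i => by
    have h := i2a i
    rw [hws] at h
    exact h
  have i2b' : ∀ i, Integrable (fun x => ⟪fderiv ℝ w x (e i),
      convect w (fun y => fderiv ℝ u y (e i)) x⟫) volume := fun i => by
    have h := i2b i
    rw [hws, hus] at h
    exact h
  refine ⟨integrable_finsetSum _ fun i _ => i2a' i, integrable_finsetSum _ fun i _ => i2b' i, ?_⟩
  rw [← hFdef, hL', integral_finsetSum _ fun i _ => i2 i, Finset.sum_congr rfl fun i _ => hsplit i,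
    Finset.sum_add_distrib, ← integral_finsetSum _ fun i _ => i2a i,
    ← integral_finsetSum _ fun i _ => i2b i, hws, hus]
  ring

/-- `2Ls ≤ κ s² + L²/κ` for `κ > 0`. [folklore] -/
private theorem r3rob_two_mul_le_kappa {L s κ : ℝ} (hκ : 0 < κ) : 2 * L * s ≤ κ * s ^ 2 + L ^ 2 / κ := by
  have h : 2 * L * s - κ * s ^ 2 ≤ L ^ 2 / κ := by
    rw [le_div_iff₀ hκ]
    nlinarith [sq_nonneg (κ * s - L)]
  linarith


/-- `∫⁻‖a + b‖² < ∞` from `∫⁻‖a‖², ∫⁻‖b‖² < ∞`. [folklore] -/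
private theorem r3rob_lintegral_sq_add_lt_top {G : Type*} [NormedAddCommGroup G]
    {a b : EuclideanSpace ℝ (Fin 3) → G}
    (ham : AEStronglyMeasurable a volume) (ha : ∫⁻ x, ‖a x‖ₑ ^ 2 < ⊤)
    (hb : ∫⁻ x, ‖b x‖ₑ ^ 2 < ⊤) : ∫⁻ x, ‖a x + b x‖ₑ ^ 2 < ⊤ := by
  have h := lintegral_enorm_sq_sub_le (g := fun x => -b x) ham (μ := volume)
  have e : ∀ x, a x + b x = a x - -b x := fun x => by rw [sub_neg_eq_add]
  simp_rw [e]
  refine lt_of_le_of_lt h ?_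
  simp_rw [enorm_neg]
  exact ENNReal.add_lt_top.2 ⟨ENNReal.mul_lt_top (by simp) ha, ENNReal.mul_lt_top (by simp) hb⟩

/-- `∫⁻‖a − b‖² < ∞` from `∫⁻‖a‖², ∫⁻‖b‖² < ∞`. [folklore] -/
private theorem r3rob_lintegral_sq_sub_lt_top {G : Type*} [NormedAddCommGroup G]
    {a b : EuclideanSpace ℝ (Fin 3) → G}
    (ham : AEStronglyMeasurable a volume) (ha : ∫⁻ x, ‖a x‖ₑ ^ 2 < ⊤)
    (hb : ∫⁻ x, ‖b x‖ₑ ^ 2 < ⊤) : ∫⁻ x, ‖a x - b x‖ₑ ^ 2 < ⊤ :=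
  lt_of_le_of_lt (lintegral_enorm_sq_sub_le (g := b) ham (μ := volume))
    (ENNReal.add_lt_top.2 ⟨ENNReal.mul_lt_top (by simp) ha, ENNReal.mul_lt_top (by simp) hb⟩)

/-- `∫⁻‖c • a‖² < ∞` from `∫⁻‖a‖² < ∞`. [folklore] -/
private theorem r3rob_lintegral_sq_smul_lt_top {G : Type*} [NormedAddCommGroup G] [NormedSpace ℝ G]
    {a : EuclideanSpace ℝ (Fin 3) → G} (c : ℝ) (ha : ∫⁻ x, ‖a x‖ₑ ^ 2 < ⊤) : ∫⁻ x, ‖c • a x‖ₑ ^ 2 <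
    ⊤ := by
  have e : ∀ x, ‖c • a x‖ₑ ^ 2 = ‖c‖ₑ ^ 2 * ‖a x‖ₑ ^ 2 := fun x => by rw [enorm_smul, mul_pow]
  simp_rw [e]
  rw [lintegral_const_mul' _ _ (ENNReal.pow_ne_top enorm_ne_top)]
  exact ENNReal.mul_lt_top (lt_top_iff_ne_top.2 (ENNReal.pow_ne_top enorm_ne_top)) ha

/-- Uniform `L²`-Sobolev bounds pass to slicewise differences: if `c(t) = a(t) − b(t)` on `S` with
smooth slices and `a, b` have all `L²` Sobolev norms bounded on `S`, so does `c`. [folklore] -/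
private theorem r3rob_sobolev_sub {F : Type*} [NormedAddCommGroup F] [NormedSpace ℝ F]
    {S : Set ℝ} {a b c : ℝ → EuclideanSpace ℝ (Fin 3) → F}
    (habc : ∀ t ∈ S, ∀ x, c t x = a t x - b t x) (ha : ∀ t ∈ S, ContDiff ℝ ∞ (a t))
    (hb : ∀ t ∈ S, ContDiff ℝ ∞ (b t))
    (hA : ∀ n : ℕ, ∃ C : ℝ≥0, ∀ t ∈ S, ∫⁻ x, ‖iteratedFDeriv ℝ n (a t) x‖ₑ ^ 2 ≤ C)
    (hB : ∀ n : ℕ, ∃ C : ℝ≥0, ∀ t ∈ S, ∫⁻ x, ‖iteratedFDeriv ℝ n (b t) x‖ₑ ^ 2 ≤ C) (n : ℕ) :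
    ∃ C : ℝ≥0, ∀ t ∈ S, ∫⁻ x, ‖iteratedFDeriv ℝ n (c t) x‖ₑ ^ 2 ≤ C := by
  obtain ⟨Ca, hCa⟩ := hA n
  obtain ⟨Cb, hCb⟩ := hB n
  refine ⟨2 * Ca + 2 * Cb, fun t ht => ?_⟩
  have hc : c t = a t - b t := funext fun x => by rw [Pi.sub_apply, habc t ht x]
  have hsub : ∀ x, iteratedFDeriv ℝ n (c t) x = iteratedFDeriv ℝ n (a t) x - iteratedFDeriv ℝ n (b t) x :=
    fun x => by
      rw [hc]
      exact iteratedFDeriv_sub_apply ((ha t ht).of_le (by exact_mod_cast le_top)).contDiffAt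
        ((hb t ht).of_le (by exact_mod_cast le_top)).contDiffAt
  have hm : AEStronglyMeasurable (fun x => iteratedFDeriv ℝ n (a t) x) volume :=
    ((ha t ht).continuous_iteratedFDeriv (by exact_mod_cast le_top)).aestronglyMeasurable
  calc ∫⁻ x, ‖iteratedFDeriv ℝ n (c t) x‖ₑ ^ 2
      = ∫⁻ x, ‖iteratedFDeriv ℝ n (a t) x - iteratedFDeriv ℝ n (b t) x‖ₑ ^ 2 :=
        lintegral_congr fun x => by rw [hsub]
    _ ≤ 2 * (∫⁻ x, ‖iteratedFDeriv ℝ n (a t) x‖ₑ ^ 2) + 2 * ∫⁻ x, ‖iteratedFDeriv ℝ n (b t) x‖ₑ ^ 2 :=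
        lintegral_enorm_sq_sub_le hm
    _ ≤ 2 * (Ca : ℝ≥0∞) + 2 * (Cb : ℝ≥0∞) := by
        gcongr
        · exact hCa t ht
        · exact hCb t ht
    _ = ((2 * Ca + 2 * Cb : ℝ≥0) : ℝ≥0∞) := by push_cast; rfl

/-- Order-zero Sobolev bound, unfolded: `∫⁻‖g‖² < ∞`. [folklore] -/
private theorem r3rob_l2_of_order_zero {F : Type*} [NormedAddCommGroup F] [NormedSpace ℝ F]
    {g : EuclideanSpace ℝ (Fin 3) → F} {C : ℝ≥0} (h : ∫⁻ x, ‖iteratedFDeriv ℝ 0 g x‖ₑ ^ 2 ≤ C) :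
    ∫⁻ x, ‖g x‖ₑ ^ 2 < ⊤ := by
  refine lt_of_le_of_lt ((le_of_eq (lintegral_congr fun x => ?_)).trans h) ENNReal.coe_lt_top
  rw [← ofReal_norm, ← ofReal_norm, norm_iteratedFDeriv_zero]

/-- Uniform-in-time Sobolev bound, at one time: `∫⁻‖Dⁿ(c t)‖² < ∞`. [folklore] -/
private theorem r3rob_fin {F : Type*} [NormedAddCommGroup F] [NormedSpace ℝ F] {S : Set ℝ}
    {c : ℝ → EuclideanSpace ℝ (Fin 3) → F} {t : ℝ} (ht : t ∈ S) (n : ℕ)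
    (hC : ∃ C : ℝ≥0, ∀ s ∈ S, ∫⁻ x, ‖iteratedFDeriv ℝ n (c s) x‖ₑ ^ 2 ≤ C) :
    ∫⁻ x, ‖iteratedFDeriv ℝ n (c t) x‖ₑ ^ 2 < ⊤ := by
  obtain ⟨C, hC⟩ := hC
  exact lt_of_le_of_lt (hC t ht) ENNReal.coe_lt_top

/-- The difference of two classical solutions (with any two forces) is divergence free. [folklore] -/
private theorem r3rob_isDivFree_sub {S : Set ℝ} {ν : ℝ}
    {f g u v : ℝ → EuclideanSpace ℝ (Fin 3) → EuclideanSpace ℝ (Fin 3)}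
    {p q : ℝ → EuclideanSpace ℝ (Fin 3) → ℝ}
    (hv : IsClassicalNSSolutionOn S ν g v q) (hu : IsClassicalNSSolutionOn S ν f u p) {t : ℝ}
    (ht : t ∈ S) : VectorCalculus.IsDivFree ((v - u) t) := by
  intro x
  have hu1 : ContDiff ℝ 1 (u t) := (hu.contDiff_velocity ht).of_le (by norm_cast)
  have hv1 : ContDiff ℝ 1 (v t) := (hv.contDiff_velocity ht).of_le (by norm_cast)
  simp only [VectorCalculus.divergence, Pi.sub_apply]
  rw [fderiv_sub (hv1.differentiable one_ne_zero x) (hu1.differentiable one_ne_zero x)]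
  have := hu.divFree t ht x
  have := hv.divFree t ht x
  simp only [VectorCalculus.divergence] at *
  simp [map_sub, *]

/-- **`∂ᵥ∇π = ∇∂ᵥπ`** for a `C²` scalar field on `ℝ³` (Schwarz). [folklore] -/
private theorem r3rob_fderiv_gradient_apply {π : EuclideanSpace ℝ (Fin 3) → ℝ} (hπ : ContDiff ℝ 2 π)
    (x v : EuclideanSpace ℝ (Fin 3)) :
    fderiv ℝ (gradient π) x v = gradient (fun y => fderiv ℝ π y v) x := by
  have hd : DifferentiableAt ℝ (fderiv ℝ π) x :=
    ((hπ.fderiv_right (m := 1) (by norm_num)).differentiable one_ne_zero) x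
  have hdg : DifferentiableAt ℝ (gradient π) x := by
    show DifferentiableAt ℝ
      (fun y => (InnerProductSpace.toDual ℝ (EuclideanSpace ℝ (Fin 3))).symm (fderiv ℝ π y)) x
    exact ((InnerProductSpace.toDual ℝ (EuclideanSpace ℝ (Fin 3))).symm.differentiable.differentiableAt).comp
      x hd
  refine ext_inner_right ℝ fun a => ?_
  have key : ∀ (φ : EuclideanSpace ℝ (Fin 3) → ℝ) (y : EuclideanSpace ℝ (Fin 3)),
      ⟪gradient φ y, a⟫ = fderiv ℝ φ y a := fun φ y => by
    rw [gradient, InnerProductSpace.toDual_symm_apply]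
  have h1 : fderiv ℝ (fun y => ⟪gradient π y, a⟫) x v = ⟪fderiv ℝ (gradient π) x v, a⟫ := by
    rw [fderiv_inner_apply ℝ hdg (differentiableAt_const a)]
    simp
  have h2 : (fun y => ⟪gradient π y, a⟫) = fun y => fderiv ℝ π y a := funext fun y => key π y
  rw [← h1, h2, key, fderiv_fderiv_apply_comm_of_contDiff_two hπ x a v]

/-- `∫‖Δw‖² ≤ 3 Σᵢ ∫|∇(∂ᵢw)|²_F` (pointwise `Δw = Σᵢ ∂ᵢ(∂ᵢw)` and Cauchy–Schwarz). [folklore] -/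
private theorem r3rob_integral_laplacian_sq_le_three_mul_sum
    {w : EuclideanSpace ℝ (Fin 3) → EuclideanSpace ℝ (Fin 3)} (hw : ContDiff ℝ ∞ w)
    (hX : ∀ i, Integrable (fun x => frobeniusNormSq
      (fderiv ℝ (fun y => fderiv ℝ w y (EuclideanSpace.basisFun (Fin 3) ℝ i)) x)) volume) :
    ∫ x, ‖(Δ w) x‖ ^ 2 ≤
      3 * ∑ i, ∫ x, frobeniusNormSq
        (fderiv ℝ (fun y => fderiv ℝ w y (EuclideanSpace.basisFun (Fin 3) ℝ i)) x) := by
  set e := EuclideanSpace.basisFun (Fin 3) ℝ with he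
  have hw2 : ContDiff ℝ 2 w := hw.of_le (by norm_cast)
  -- `(a + b + c)² ≤ 3(a² + b² + c²)`
  have h3 : ∀ a b c : ℝ, (a + b + c) ^ 2 ≤ 3 * (a ^ 2 + b ^ 2 + c ^ 2) := fun a b c => by
    nlinarith [sq_nonneg (a - b), sq_nonneg (b - c), sq_nonneg (a - c)]
  -- pointwise bound
  have hpt : ∀ x, ‖(Δ w) x‖ ^ 2 ≤
      3 * ∑ i, frobeniusNormSq (fderiv ℝ (fun y => fderiv ℝ w y (e i)) x) := by
    intro x
    have hd : DifferentiableAt ℝ (fderiv ℝ w) x :=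
      ((hw2.fderiv_right (m := 1) le_rfl).differentiable one_ne_zero) x
    have hΔ : (Δ w) x = ∑ i, fderiv ℝ (fun y => fderiv ℝ w y (e i)) x (e i) := by
      rw [laplacian_eq_iteratedFDeriv_orthonormalBasis w e]
      refine Finset.sum_congr rfl fun i _ => ?_
      rw [iteratedFDeriv_two_apply, FluidPDE.fderiv_apply_const_apply hd (e i) (e i)]
      rfl
    have hi : ∀ i, ‖fderiv ℝ (fun y => fderiv ℝ w y (e i)) x (e i)‖ ^ 2 ≤
        frobeniusNormSq (fderiv ℝ (fun y => fderiv ℝ w y (e i)) x) := fun i => by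
      rw [frobeniusNormSq_eq_sum e]
      exact Finset.single_le_sum
        (f := fun k => ‖fderiv ℝ (fun y => fderiv ℝ w y (e i)) x (e k)‖ ^ 2)
        (fun k _ => sq_nonneg _) (Finset.mem_univ i)
    rw [hΔ]
    have hns := norm_sum_le (Finset.univ : Finset (Fin 3))
      (fun i => fderiv ℝ (fun y => fderiv ℝ w y (e i)) x (e i))
    generalize hq : (fun i => fderiv ℝ (fun y => fderiv ℝ w y (e i)) x) = q at *
    have hq' : ∀ i, fderiv ℝ (fun y => fderiv ℝ w y (e i)) x = q i := fun i => by rw [← hq]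
    simp only [hq'] at hns hi ⊢
    rw [Fin.sum_univ_three, Fin.sum_univ_three] at hns
    rw [Fin.sum_univ_three, Fin.sum_univ_three]
    have h0 := norm_nonneg (q 0 (e 0) + q 1 (e 1) + q 2 (e 2))
    calc ‖q 0 (e 0) + q 1 (e 1) + q 2 (e 2)‖ ^ 2
        ≤ (‖q 0 (e 0)‖ + ‖q 1 (e 1)‖ + ‖q 2 (e 2)‖) ^ 2 := pow_le_pow_left₀ h0 hns 2
      _ ≤ 3 * (‖q 0 (e 0)‖ ^ 2 + ‖q 1 (e 1)‖ ^ 2 + ‖q 2 (e 2)‖ ^ 2) := h3 _ _ _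
      _ ≤ 3 * (frobeniusNormSq (q 0) + frobeniusNormSq (q 1) + frobeniusNormSq (q 2)) := by
          linarith [hi 0, hi 1, hi 2]
  have iS : Integrable (fun x => ∑ i, frobeniusNormSq (fderiv ℝ (fun y => fderiv ℝ w y (e i)) x))
      volume := integrable_finsetSum _ fun i _ => hX i
  have hR : (∫ x, 3 * ∑ i, frobeniusNormSq (fderiv ℝ (fun y => fderiv ℝ w y (e i)) x)) =
      3 * ∑ i, ∫ x, frobeniusNormSq (fderiv ℝ (fun y => fderiv ℝ w y (e i)) x) := by
    rw [integral_const_mul, integral_finsetSum _ fun i _ => hX i]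
  by_cases hint : Integrable (fun x => ‖(Δ w) x‖ ^ 2) volume
  · rw [← hR]
    exact integral_mono hint (iS.const_mul 3) fun x => hpt x
  · rw [integral_undef hint]
    exact mul_nonneg (by norm_num) (Finset.sum_nonneg fun i _ =>
      integral_nonneg fun x => frobeniusNormSq_nonneg _)


/-- `∫|∇z|²_F < ∞` for a `C¹` field with `Dz ∈ L²` (`|·|²_F ≤ 3‖·‖²` on `ℝ³`). [folklore] -/
private theorem r3rob_integrable_frobeniusNormSq
    {z : EuclideanSpace ℝ (Fin 3) → EuclideanSpace ℝ (Fin 3)} (hz : ContDiff ℝ 1 z)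
    (hz1 : ∫⁻ x, ‖iteratedFDeriv ℝ 1 z x‖ₑ ^ 2 < ⊤) :
    Integrable (fun x => frobeniusNormSq (fderiv ℝ z x)) volume := by
  refine integrable_of_continuous_of_nonneg
    (FluidPDE.continuous_frobeniusNormSq_fderiv hz one_ne_zero) (fun x => frobeniusNormSq_nonneg _) ?_
  calc ∫⁻ x, ENNReal.ofReal (frobeniusNormSq (fderiv ℝ z x))
      ≤ ∫⁻ x, 3 * ‖iteratedFDeriv ℝ 1 z x‖ₑ ^ 2 :=
        lintegral_mono fun x => by
          rw [← ofReal_norm, norm_iteratedFDeriv_one, ofReal_norm]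
          exact ofReal_frobeniusNormSq_le_three_mul_enorm_sq _
    _ = 3 * ∫⁻ x, ‖iteratedFDeriv ℝ 1 z x‖ₑ ^ 2 := lintegral_const_mul' _ _ (by norm_num)
    _ < ⊤ := ENNReal.mul_lt_top (by norm_num) hz1

/-- A bound `G` of the compression rate of a divergence-free field on `ℝ³` is nonnegative (the
trace `Σᵢ⟪Du eᵢ, eᵢ⟫ = div u` vanishes). [folklore] -/
private theorem r3rob_compressionRate_nonneg
    {u₀ : EuclideanSpace ℝ (Fin 3) → EuclideanSpace ℝ (Fin 3)} (hdiv : VectorCalculus.IsDivFree u₀)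
    {G : ℝ} (hG : ∀ (x ξ : EuclideanSpace ℝ (Fin 3)), -⟪fderiv ℝ u₀ x ξ, ξ⟫ ≤ G * ‖ξ‖ ^ 2) :
    0 ≤ G := by
  have hd := hdiv 0
  rw [divergence_eq_sum_inner_fderiv (EuclideanSpace.basisFun (Fin 3) ℝ), Fin.sum_univ_three] at hd
  have he : ∀ i, ‖EuclideanSpace.basisFun (Fin 3) ℝ i‖ = 1 := fun i => by simp
  have h0 := hG 0 (EuclideanSpace.basisFun (Fin 3) ℝ 0)
  have h1 := hG 0 (EuclideanSpace.basisFun (Fin 3) ℝ 1)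
  have h2 := hG 0 (EuclideanSpace.basisFun (Fin 3) ℝ 2)
  rw [he, one_pow, mul_one, real_inner_comm] at h0 h1 h2
  linarith

end Helpers

/-! ## §B The `H²` level (Dashti–Robinson 2008, Thm 2, in strain form): slice calculus -/

section H2

/-- **Three-field integration by parts for a convective pairing**: for `C^∞` fields `a, b, c` on
`ℝ³` with `Da, D²a ∈ L²`, `b, Db ∈ L²` and `Dc, D²c` bounded,
`∫⟪Δa, (b·∇)c⟫ = −Σⱼ∫⟪∂ⱼa, Dc(∂ⱼb)⟫ − Σⱼ∫⟪∂ⱼa, (b·∇)∂ⱼc⟫` (the case `a = b` is the stretching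
identity of §4b). [folklore] -/
private theorem r3rob_integral_inner_laplacian_convect3
    {a b c : EuclideanSpace ℝ (Fin 3) → EuclideanSpace ℝ (Fin 3)} (ha : ContDiff ℝ ∞ a)
    (hb : ContDiff ℝ ∞ b) (hc : ContDiff ℝ ∞ c)
    {C₁ : ℝ} (hC₁ : ∀ x, ‖fderiv ℝ c x‖ ≤ C₁) {C₂ : ℝ} (hC₂ : ∀ x, ‖iteratedFDeriv ℝ 2 c x‖ ≤ C₂)
    (hb0 : ∫⁻ x, ‖b x‖ₑ ^ 2 < ⊤) (hb1 : ∫⁻ x, ‖fderiv ℝ b x‖ₑ ^ 2 < ⊤)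
    (ha1 : ∫⁻ x, ‖fderiv ℝ a x‖ₑ ^ 2 < ⊤) (ha2 : ∫⁻ x, ‖iteratedFDeriv ℝ 2 a x‖ₑ ^ 2 < ⊤) :
    (Integrable (fun x => ∑ j, ⟪fderiv ℝ a x (EuclideanSpace.basisFun (Fin 3) ℝ j),
        fderiv ℝ c x (fderiv ℝ b x (EuclideanSpace.basisFun (Fin 3) ℝ j))⟫) volume) ∧
    (Integrable (fun x => ∑ j, ⟪fderiv ℝ a x (EuclideanSpace.basisFun (Fin 3) ℝ j),
        convect b (fun y => fderiv ℝ c y (EuclideanSpace.basisFun (Fin 3) ℝ j)) x⟫) volume) ∧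
    ∫ x, ⟪(Δ a) x, convect b c x⟫ =
      - (∫ x, ∑ j, ⟪fderiv ℝ a x (EuclideanSpace.basisFun (Fin 3) ℝ j),
          fderiv ℝ c x (fderiv ℝ b x (EuclideanSpace.basisFun (Fin 3) ℝ j))⟫)
      - ∫ x, ∑ j, ⟪fderiv ℝ a x (EuclideanSpace.basisFun (Fin 3) ℝ j),
          convect b (fun y => fderiv ℝ c y (EuclideanSpace.basisFun (Fin 3) ℝ j)) x⟫ := by
  set e := EuclideanSpace.basisFun (Fin 3) ℝ with he
  have he1 : ∀ i, ‖e i‖ = 1 := fun i => by simp [he]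
  have hC₁0 : 0 ≤ C₁ := (norm_nonneg _).trans (hC₁ 0)
  have hC₂0 : 0 ≤ C₂ := (norm_nonneg _).trans (hC₂ 0)
  have ha2' : ContDiff ℝ 2 a := ha.of_le (by norm_cast)
  have ha1' : ContDiff ℝ 1 a := ha.of_le (by norm_cast)
  have hb1' : ContDiff ℝ 1 b := hb.of_le (by norm_cast)
  have hc1' : ContDiff ℝ 1 c := hc.of_le (by norm_cast)
  obtain ⟨F, hFdef⟩ : ∃ F : EuclideanSpace ℝ (Fin 3) → EuclideanSpace ℝ (Fin 3),
      F = convect b c := ⟨_, rfl⟩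
  have hF : ContDiff ℝ 1 F := by
    rw [hFdef]; exact (hc.fderiv_right (m := 1) (by norm_cast)).clm_apply hb1'
  -- slices
  obtain ⟨as, has⟩ : ∃ as : Fin 3 → EuclideanSpace ℝ (Fin 3) → EuclideanSpace ℝ (Fin 3),
      as = fun j y => fderiv ℝ a y (e j) := ⟨_, rfl⟩
  obtain ⟨bs, hbs⟩ : ∃ bs : Fin 3 → EuclideanSpace ℝ (Fin 3) → EuclideanSpace ℝ (Fin 3),
      bs = fun j y => fderiv ℝ b y (e j) := ⟨_, rfl⟩
  obtain ⟨cs, hcs⟩ : ∃ cs : Fin 3 → EuclideanSpace ℝ (Fin 3) → EuclideanSpace ℝ (Fin 3),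
      cs = fun j y => fderiv ℝ c y (e j) := ⟨_, rfl⟩
  have has2 : ∀ j, ContDiff ℝ 2 (as j) := fun j => by
    rw [has]; exact (ha.fderiv_right (m := 2) (by norm_cast)).clm_apply contDiff_const
  have has1 : ∀ j, ContDiff ℝ 1 (as j) := fun j => (has2 j).of_le (by norm_num)
  have hcs1 : ∀ j, ContDiff ℝ 1 (cs j) := fun j => by
    rw [hcs]; exact (hc.fderiv_right (m := 1) (by norm_cast)).clm_apply contDiff_const
  -- continuity
  have cb : Continuous b := hb.continuous
  have cDa : Continuous (fderiv ℝ a) := ha1'.continuous_fderiv one_ne_zero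
  have cDb : Continuous (fderiv ℝ b) := hb1'.continuous_fderiv one_ne_zero
  have cDc : Continuous (fderiv ℝ c) := hc1'.continuous_fderiv one_ne_zero
  have cas : ∀ j, Continuous (as j) := fun j => (has1 j).continuous
  have cbs : ∀ j, Continuous (bs j) := fun j => by rw [hbs]; exact cDb.clm_apply continuous_const
  have cDas : ∀ j, Continuous (fderiv ℝ (as j)) := fun j => (has1 j).continuous_fderiv one_ne_zero
  have cDcs : ∀ j, Continuous (fderiv ℝ (cs j)) := fun j => (hcs1 j).continuous_fderiv one_ne_zero
  have cdda : ∀ j, Continuous fun x => fderiv ℝ (as j) x (e j) := fun j =>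
    (cDas j).clm_apply continuous_const
  have cF : Continuous F := by rw [hFdef]; exact cDc.clm_apply cb
  -- pointwise norm bounds
  have n_as : ∀ j x, ‖as j x‖ ≤ ‖fderiv ℝ a x‖ := fun j x => by
    rw [has]; simpa [he1] using (fderiv ℝ a x).le_opNorm (e j)
  have n_bs : ∀ j x, ‖bs j x‖ ≤ ‖fderiv ℝ b x‖ := fun j x => by
    rw [hbs]; simpa [he1] using (fderiv ℝ b x).le_opNorm (e j)
  have n_Das : ∀ j x, ‖fderiv ℝ (as j) x‖ ≤ ‖iteratedFDeriv ℝ 2 a x‖ := fun j x => by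
    have h : ‖fderiv ℝ (as j) x‖ = ‖iteratedFDeriv ℝ 1 (as j) x‖ := by
      rw [← norm_iteratedFDeriv_fderiv, norm_iteratedFDeriv_zero]
    rw [h, has]
    exact norm_iteratedFDeriv_fderiv_apply_basisFun_le ha 1 (by norm_cast) x j
  have n_dda : ∀ j x, ‖fderiv ℝ (as j) x (e j)‖ ≤ ‖iteratedFDeriv ℝ 2 a x‖ := fun j x => by
    have h1 : ‖fderiv ℝ (as j) x (e j)‖ ≤ ‖fderiv ℝ (as j) x‖ := by
      simpa [he1] using (fderiv ℝ (as j) x).le_opNorm (e j)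
    exact h1.trans (n_Das j x)
  have n_Dcs : ∀ j x, ‖fderiv ℝ (cs j) x‖ ≤ C₂ := fun j x => by
    have h : ‖fderiv ℝ (cs j) x‖ = ‖iteratedFDeriv ℝ 1 (cs j) x‖ := by
      rw [← norm_iteratedFDeriv_fderiv, norm_iteratedFDeriv_zero]
    rw [h, hcs]
    exact (norm_iteratedFDeriv_fderiv_apply_basisFun_le hc 1 (by norm_cast) x j).trans (hC₂ x)
  have n_F : ∀ x, ‖F x‖ ≤ ‖C₁ * ‖b x‖‖ := fun x => by
    rw [hFdef, convect, Real.norm_of_nonneg (mul_nonneg hC₁0 (norm_nonneg _))]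
    exact (fderiv ℝ c x).le_of_opNorm_le (hC₁ x) (b x)
  -- finite `L²` norms
  have l2as : ∀ j, ∫⁻ x, ‖as j x‖ₑ ^ 2 < ⊤ := fun j =>
    lintegral_enorm_sq_lt_top_of_norm_le (n_as j) ha1
  have l2dda : ∀ j, ∫⁻ x, ‖fderiv ℝ (as j) x (e j)‖ₑ ^ 2 < ⊤ := fun j =>
    lintegral_enorm_sq_lt_top_of_norm_le (n_dda j) ha2
  have l2F : ∫⁻ x, ‖F x‖ₑ ^ 2 < ⊤ :=
    lintegral_enorm_sq_lt_top_of_norm_le n_F (r3rob_lintegral_sq_mul_norm_lt_top C₁ hb0)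
  -- the derivative of `F`: `∂ⱼF = Dc(∂ⱼb) + (b·∇)(∂ⱼc)`
  have hdF : ∀ j x, fderiv ℝ F x (e j) = fderiv ℝ c x (bs j x) + convect b (cs j) x := by
    intro j x
    rw [hFdef, fderiv_convect_apply_of_contDiff hb hc x (e j), hbs, hcs]
  have n_pa : ∀ j x, ‖fderiv ℝ c x (bs j x)‖ ≤ ‖C₁ * ‖fderiv ℝ b x‖‖ := fun j x => by
    rw [Real.norm_of_nonneg (mul_nonneg hC₁0 (norm_nonneg _))]
    exact ((fderiv ℝ c x).le_of_opNorm_le (hC₁ x) (bs j x)).trans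
      (mul_le_mul_of_nonneg_left (n_bs j x) hC₁0)
  have n_pb : ∀ j x, ‖convect b (cs j) x‖ ≤ ‖C₂ * ‖b x‖‖ := fun j x => by
    rw [convect, Real.norm_of_nonneg (mul_nonneg hC₂0 (norm_nonneg _))]
    exact (fderiv ℝ (cs j) x).le_of_opNorm_le (n_Dcs j x) (b x)
  have cpa : ∀ j, Continuous fun x => fderiv ℝ c x (bs j x) := fun j => cDc.clm_apply (cbs j)
  have cpb : ∀ j, Continuous (convect b (cs j)) := fun j => (cDcs j).clm_apply cb
  have l2pa : ∀ j, ∫⁻ x, ‖fderiv ℝ c x (bs j x)‖ₑ ^ 2 < ⊤ := fun j =>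
    lintegral_enorm_sq_lt_top_of_norm_le (n_pa j) (r3rob_lintegral_sq_mul_norm_lt_top C₁ hb1)
  have l2pb : ∀ j, ∫⁻ x, ‖convect b (cs j) x‖ₑ ^ 2 < ⊤ := fun j =>
    lintegral_enorm_sq_lt_top_of_norm_le (n_pb j) (r3rob_lintegral_sq_mul_norm_lt_top C₂ hb0)
  have i2a : ∀ j, Integrable (fun x => ⟪as j x, fderiv ℝ c x (bs j x)⟫) volume := fun j =>
    integrable_of_norm_le_mul_of_lintegral_sq ((cas j).inner (cpa j)).aestronglyMeasurable (cas j)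
      (cpa j) (l2as j) (l2pa j) fun x => norm_inner_le_norm _ _
  have i2b : ∀ j, Integrable (fun x => ⟪as j x, convect b (cs j) x⟫) volume := fun j =>
    integrable_of_norm_le_mul_of_lintegral_sq ((cas j).inner (cpb j)).aestronglyMeasurable (cas j)
      (cpb j) (l2as j) (l2pb j) fun x => norm_inner_le_norm _ _
  -- integrability for the integration by parts
  have i1 : ∀ j, Integrable (fun x => ⟪fderiv ℝ (fun y => fderiv ℝ a y (e j)) x (e j), F x⟫)
      volume := fun j => by
    have h : Integrable (fun x => ⟪fderiv ℝ (as j) x (e j), F x⟫) volume :=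
      integrable_of_norm_le_mul_of_lintegral_sq ((cdda j).inner cF).aestronglyMeasurable (cdda j)
        cF (l2dda j) l2F fun x => norm_inner_le_norm _ _
    rw [has] at h
    exact h
  have i2 : ∀ j, Integrable (fun x => ⟪fderiv ℝ a x (e j), fderiv ℝ F x (e j)⟫) volume :=
    fun j => by
    have h := (i2a j).add (i2b j)
    refine h.congr (Eventually.of_forall fun x => ?_)
    simp only [Pi.add_apply, hdF j x, inner_add_right, has]
  have i3 : ∀ j, Integrable (fun x => ⟪fderiv ℝ a x (e j), F x⟫) volume := fun j => by
    have h : Integrable (fun x => ⟪as j x, F x⟫) volume :=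
      integrable_of_norm_le_mul_of_lintegral_sq ((cas j).inner cF).aestronglyMeasurable (cas j)
        cF (l2as j) l2F fun x => norm_inner_le_norm _ _
    rw [has] at h
    exact h
  -- integration by parts
  have hL := integral_sum_inner_fderiv_fderiv_eq_neg_integral_inner_laplacian ha2' hF i1 i2 i3
  have hsplit : ∀ j, ∫ x, ⟪fderiv ℝ a x (e j), fderiv ℝ F x (e j)⟫ =
      (∫ x, ⟪as j x, fderiv ℝ c x (bs j x)⟫) + ∫ x, ⟪as j x, convect b (cs j) x⟫ := by
    intro j
    have h1 : (fun x => ⟪fderiv ℝ a x (e j), fderiv ℝ F x (e j)⟫) =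
        fun x => ⟪as j x, fderiv ℝ c x (bs j x)⟫ + ⟪as j x, convect b (cs j) x⟫ :=
      funext fun x => by rw [hdF j x, inner_add_right, has]
    rw [h1, integral_add (i2a j) (i2b j)]
  have hL' : ∫ x, ⟪(Δ a) x, F x⟫ = - ∫ x, ∑ j, ⟪fderiv ℝ a x (e j), fderiv ℝ F x (e j)⟫ := by
    rw [hL, neg_neg]
  have i2a' : ∀ j, Integrable (fun x => ⟪fderiv ℝ a x (e j),
      fderiv ℝ c x (fderiv ℝ b x (e j))⟫) volume := fun j => by
    have h := i2a j
    rw [has, hbs] at h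
    exact h
  have i2b' : ∀ j, Integrable (fun x => ⟪fderiv ℝ a x (e j),
      convect b (fun y => fderiv ℝ c y (e j)) x⟫) volume := fun j => by
    have h := i2b j
    rw [has, hcs] at h
    exact h
  refine ⟨integrable_finsetSum _ fun j _ => i2a' j, integrable_finsetSum _ fun j _ => i2b' j, ?_⟩
  rw [← hFdef, hL', integral_finsetSum _ fun j _ => i2 j, Finset.sum_congr rfl fun j _ => hsplit j,
    Finset.sum_add_distrib, ← integral_finsetSum _ fun j _ => i2a j,
    ← integral_finsetSum _ fun j _ => i2b j, has, hbs, hcs]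
  ring

/-- `∫ ‖a‖‖b‖ ≤ √(∫|·|²_F-majorant) …`: Cauchy–Schwarz with operator norms bounded by Frobenius
norms, the shape used for every cross term below. [folklore] -/
private theorem r3rob_integral_opNorm_mul_le {a c : EuclideanSpace ℝ (Fin 3) → EuclideanSpace ℝ (Fin 3)}
    (ha : ContDiff ℝ 1 a) (hc : ContDiff ℝ 1 c)
    (ha1 : ∫⁻ x, ‖fderiv ℝ a x‖ₑ ^ 2 < ⊤) (hc1 : ∫⁻ x, ‖fderiv ℝ c x‖ₑ ^ 2 < ⊤)
    (haF : ∫⁻ x, ENNReal.ofReal (frobeniusNormSq (fderiv ℝ a x)) < ⊤)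
    (hcF : ∫⁻ x, ENNReal.ofReal (frobeniusNormSq (fderiv ℝ c x)) < ⊤) :
    Integrable (fun x => ‖fderiv ℝ a x‖ * ‖fderiv ℝ c x‖) volume ∧
    ∫ x, ‖fderiv ℝ a x‖ * ‖fderiv ℝ c x‖ ≤
      Real.sqrt (∫ x, frobeniusNormSq (fderiv ℝ a x)) *
        Real.sqrt (∫ x, frobeniusNormSq (fderiv ℝ c x)) := by
  have cDa : Continuous (fderiv ℝ a) := ha.continuous_fderiv one_ne_zero
  have cDc : Continuous (fderiv ℝ c) := hc.continuous_fderiv one_ne_zero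
  have mDa : MemLp (fderiv ℝ a) 2 volume := r3rob_memLp_two cDa ha1
  have mDc : MemLp (fderiv ℝ c) 2 volume := r3rob_memLp_two cDc hc1
  have hcs := integral_norm_mul_norm_le_sqrt_mul_sqrt mDa mDc
  have iprod : Integrable (fun x => ‖fderiv ℝ a x‖ * ‖fderiv ℝ c x‖) volume :=
    integrable_of_norm_le_mul_of_lintegral_sq ((cDa.norm.mul cDc.norm).aestronglyMeasurable) cDa cDc
      ha1 hc1 (fun x => by rw [Real.norm_of_nonneg (mul_nonneg (norm_nonneg _) (norm_nonneg _))])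
  have ifa : Integrable (fun x => frobeniusNormSq (fderiv ℝ a x)) volume :=
    integrable_of_continuous_of_nonneg (FluidPDE.continuous_frobeniusNormSq_fderiv ha one_ne_zero)
      (fun x => frobeniusNormSq_nonneg _) haF
  have ifc : Integrable (fun x => frobeniusNormSq (fderiv ℝ c x)) volume :=
    integrable_of_continuous_of_nonneg (FluidPDE.continuous_frobeniusNormSq_fderiv hc one_ne_zero)
      (fun x => frobeniusNormSq_nonneg _) hcF
  have hXa : Real.sqrt (∫ x, ‖fderiv ℝ a x‖ ^ 2) ≤ Real.sqrt (∫ x, frobeniusNormSq (fderiv ℝ a x)) :=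
    Real.sqrt_le_sqrt (integral_mono (FluidPDE.integrable_sq_norm_of_lintegral_lt_top cDa ha1) ifa
      fun x => FluidPDE.sq_opNorm_le_frobeniusNormSq _)
  have hXc : Real.sqrt (∫ x, ‖fderiv ℝ c x‖ ^ 2) ≤ Real.sqrt (∫ x, frobeniusNormSq (fderiv ℝ c x)) :=
    Real.sqrt_le_sqrt (integral_mono (FluidPDE.integrable_sq_norm_of_lintegral_lt_top cDc hc1) ifc
      fun x => FluidPDE.sq_opNorm_le_frobeniusNormSq _)
  exact ⟨iprod, hcs.trans (mul_le_mul hXa hXc (Real.sqrt_nonneg _) (Real.sqrt_nonneg _))⟩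

/-- **The six `H²`-level pairings in one direction** (Dashti–Robinson 2008, proof of Thm 2, in
strain form). For `C^∞` fields on `ℝ³`: `u` (reference, `div u = 0`, strain rate `G`, `‖D²u‖ ≤ σ₂`),
`w` (the difference), `a` (playing `∂ᵢw`) and `b` (playing `∂ᵢu`, `‖Db‖ ≤ σ₂`, `‖D²b‖ ≤ σ₃`),
with `Xa = ∫|∇a|²_F`, `Ya = ∫‖Δa‖²`, `X₁ = ∫|∇w|²_F`, `‖w‖ ≤ M_w`, `‖w‖_{L²} ≤ L`:
`∫⟪(u·∇)a + (w·∇)a + (a·∇)u + (w·∇)b + Dw(b) + Dw(a), Δa⟫ + ∫Σⱼ⟪∂ⱼa, D(∂ⱼw)(b)⟫`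
`  ≤ 2G·Xa + 9σ₂√X₁√Xa + 3σ₃L√Xa + M_w√Xa√Ya + A(XaYa)^{1/4}√X₁√Ya`
(the last integral is the part of `∫⟪Dw(b), Δa⟫` that only the sum over directions controls,
by the symmetry of second derivatives). [folklore] -/
private theorem r3rob_H2_pairings {u w a b : EuclideanSpace ℝ (Fin 3) → EuclideanSpace ℝ (Fin 3)}
    (hu : ContDiff ℝ ∞ u) (hw : ContDiff ℝ ∞ w) (ha : ContDiff ℝ ∞ a) (hb : ContDiff ℝ ∞ b)
    (hdivu : VectorCalculus.IsDivFree u)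
    {B : ℝ} (hB : ∀ x, ‖u x‖ ≤ B) {B₁ : ℝ} (hB₁ : ∀ x, ‖fderiv ℝ u x‖ ≤ B₁)
    {G : ℝ} (hG : ∀ x (ξ : EuclideanSpace ℝ (Fin 3)), -⟪fderiv ℝ u x ξ, ξ⟫ ≤ G * ‖ξ‖ ^ 2)
    {σ₂ : ℝ} (hσ₂ : ∀ x, ‖iteratedFDeriv ℝ 2 u x‖ ≤ σ₂)
    {σ₃ : ℝ} (hb1 : ∀ x, ‖fderiv ℝ b x‖ ≤ σ₂) (hb2 : ∀ x, ‖iteratedFDeriv ℝ 2 b x‖ ≤ σ₃)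
    (hbl0 : ∫⁻ x, ‖b x‖ₑ ^ 2 < ⊤) (hbl1 : ∫⁻ x, ‖fderiv ℝ b x‖ₑ ^ 2 < ⊤)
    (hw0 : ∫⁻ x, ‖w x‖ₑ ^ 2 < ⊤) (hw1 : ∫⁻ x, ‖iteratedFDeriv ℝ 1 w x‖ₑ ^ 2 < ⊤)
    {Bw₁ : ℝ} (hBw₁ : ∀ x, ‖fderiv ℝ w x‖ ≤ Bw₁) {Bw₂ : ℝ} (hBw₂ : ∀ x, ‖iteratedFDeriv ℝ 2 w x‖ ≤ Bw₂)
    {Mw : ℝ} (hMw0 : 0 ≤ Mw) (hMw : ∀ x, ‖w x‖ ≤ Mw) {L : ℝ} (hL : Real.sqrt (∫ x, ‖w x‖ ^ 2) ≤ L)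
    {A : ℝ} (hA : AgmonBoundR3 A) (han : ∀ n : ℕ, ∫⁻ x, ‖iteratedFDeriv ℝ n a x‖ₑ ^ 2 < ⊤)
    (na : ∀ x, ‖a x‖ ≤ ‖fderiv ℝ w x‖) :
    (Integrable (fun x => ∑ j, ⟪fderiv ℝ a x (EuclideanSpace.basisFun (Fin 3) ℝ j),
        convect b (fun y => fderiv ℝ w y (EuclideanSpace.basisFun (Fin 3) ℝ j)) x⟫) volume) ∧
    (∫ x, ⟪convect u a x + convect w a x + convect a u x + convect w b x + fderiv ℝ w x (b x) +
        fderiv ℝ w x (a x), (Δ a) x⟫) +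
      ∫ x, ∑ j, ⟪fderiv ℝ a x (EuclideanSpace.basisFun (Fin 3) ℝ j),
        convect b (fun y => fderiv ℝ w y (EuclideanSpace.basisFun (Fin 3) ℝ j)) x⟫ ≤
      2 * G * (∫ x, frobeniusNormSq (fderiv ℝ a x)) +
        9 * σ₂ * Real.sqrt (∫ x, frobeniusNormSq (fderiv ℝ w x)) *
          Real.sqrt (∫ x, frobeniusNormSq (fderiv ℝ a x)) +
        3 * σ₃ * L * Real.sqrt (∫ x, frobeniusNormSq (fderiv ℝ a x)) +
        Mw * Real.sqrt (∫ x, frobeniusNormSq (fderiv ℝ a x)) * Real.sqrt (∫ x, ‖(Δ a) x‖ ^ 2) +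
        A * ((∫ x, frobeniusNormSq (fderiv ℝ a x)) * (∫ x, ‖(Δ a) x‖ ^ 2)) ^ (1 / 4 : ℝ) *
          Real.sqrt (∫ x, frobeniusNormSq (fderiv ℝ w x)) * Real.sqrt (∫ x, ‖(Δ a) x‖ ^ 2) := by
  have ha0 := han 0
  have ha1 := han 1
  have ha2 := han 2
  set e := EuclideanSpace.basisFun (Fin 3) ℝ with he
  have he1 : ∀ i, ‖e i‖ = 1 := fun i => by simp [he]
  -- regularity
  have ha1' : ContDiff ℝ 1 a := ha.of_le (by norm_cast)
  have hw1' : ContDiff ℝ 1 w := hw.of_le (by norm_cast)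
  have hu1' : ContDiff ℝ 1 u := hu.of_le (by norm_cast)
  have hb1' : ContDiff ℝ 1 b := hb.of_le (by norm_cast)
  have ca : Continuous a := ha.continuous
  have cw : Continuous w := hw.continuous
  have cu : Continuous u := hu.continuous
  have cb : Continuous b := hb.continuous
  have cDa : Continuous (fderiv ℝ a) := ha1'.continuous_fderiv one_ne_zero
  have cDw : Continuous (fderiv ℝ w) := hw1'.continuous_fderiv one_ne_zero
  have cDu : Continuous (fderiv ℝ u) := hu1'.continuous_fderiv one_ne_zero
  have cDb : Continuous (fderiv ℝ b) := hb1'.continuous_fderiv one_ne_zero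
  have cΔ : Continuous fun x => (Δ a) x :=
    (contDiff_one_laplacian_of_contDiff_three (ha.of_le (by norm_cast))).continuous
  have hσ₂0 : 0 ≤ σ₂ := (norm_nonneg _).trans (hσ₂ 0)
  have hσ₃0 : 0 ≤ σ₃ := (norm_nonneg _).trans (hb2 0)
  have hL0 : 0 ≤ L := (Real.sqrt_nonneg _).trans hL
  -- `L²` data of `a` and `w`
  have ha0' : ∫⁻ x, ‖a x‖ₑ ^ 2 < ⊤ := by
    refine lt_of_le_of_lt (le_of_eq (lintegral_congr fun x => ?_)) ha0
    rw [← ofReal_norm, ← ofReal_norm, norm_iteratedFDeriv_zero]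
  have hDa_eq : ∀ x, ‖fderiv ℝ a x‖ = ‖iteratedFDeriv ℝ 1 a x‖ := fun x => by
    rw [← norm_iteratedFDeriv_fderiv, norm_iteratedFDeriv_zero]
  have l2Da : ∫⁻ x, ‖fderiv ℝ a x‖ₑ ^ 2 < ⊤ :=
    lintegral_enorm_sq_lt_top_of_norm_le (fun x => (hDa_eq x).le) ha1
  have hDw_eq : ∀ x, ‖fderiv ℝ w x‖ = ‖iteratedFDeriv ℝ 1 w x‖ := fun x => by
    rw [← norm_iteratedFDeriv_fderiv, norm_iteratedFDeriv_zero]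
  have l2Dw : ∫⁻ x, ‖fderiv ℝ w x‖ₑ ^ 2 < ⊤ :=
    lintegral_enorm_sq_lt_top_of_norm_le (fun x => (hDw_eq x).le) hw1
  have haF : ∫⁻ x, ENNReal.ofReal (frobeniusNormSq (fderiv ℝ a x)) < ⊤ := by
    calc ∫⁻ x, ENNReal.ofReal (frobeniusNormSq (fderiv ℝ a x))
        ≤ ∫⁻ x, 3 * ‖iteratedFDeriv ℝ 1 a x‖ₑ ^ 2 := lintegral_mono fun x => by
          rw [← ofReal_norm, norm_iteratedFDeriv_one, ofReal_norm]
          exact ofReal_frobeniusNormSq_le_three_mul_enorm_sq _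
      _ = 3 * ∫⁻ x, ‖iteratedFDeriv ℝ 1 a x‖ₑ ^ 2 := lintegral_const_mul' _ _ (by norm_num)
      _ < ⊤ := ENNReal.mul_lt_top (by norm_num) ha1
  have hwF : ∫⁻ x, ENNReal.ofReal (frobeniusNormSq (fderiv ℝ w x)) < ⊤ := by
    calc ∫⁻ x, ENNReal.ofReal (frobeniusNormSq (fderiv ℝ w x))
        ≤ ∫⁻ x, 3 * ‖iteratedFDeriv ℝ 1 w x‖ₑ ^ 2 := lintegral_mono fun x => by
          rw [← ofReal_norm, norm_iteratedFDeriv_one, ofReal_norm]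
          exact ofReal_frobeniusNormSq_le_three_mul_enorm_sq _
      _ = 3 * ∫⁻ x, ‖iteratedFDeriv ℝ 1 w x‖ₑ ^ 2 := lintegral_const_mul' _ _ (by norm_num)
      _ < ⊤ := ENNReal.mul_lt_top (by norm_num) hw1
  have hΔ2 : ∫⁻ x, ‖(Δ a) x‖ₑ ^ 2 < ⊤ := by
    have hle : ∀ x, ‖(Δ a) x‖ ≤ ‖(3 : ℝ) • iteratedFDeriv ℝ 2 a x‖ := fun x => by
      rw [norm_smul, Real.norm_of_nonneg (by norm_num : (0 : ℝ) ≤ 3)]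
      exact norm_laplacian_le_three_mul_norm_iteratedFDeriv_two (ha.of_le (by norm_cast)) x
    have h9 : ∫⁻ x, ‖(3 : ℝ) • iteratedFDeriv ℝ 2 a x‖ₑ ^ 2 < ⊤ := by
      have e3 : ∀ x, ‖(3 : ℝ) • iteratedFDeriv ℝ 2 a x‖ₑ ^ 2 =
          ENNReal.ofReal 3 ^ 2 * ‖iteratedFDeriv ℝ 2 a x‖ₑ ^ 2 := fun x => by
        rw [enorm_smul, mul_pow, Real.enorm_eq_ofReal (by norm_num : (0 : ℝ) ≤ 3)]
      simp_rw [e3]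
      rw [lintegral_const_mul' _ _ (ENNReal.pow_ne_top ENNReal.ofReal_ne_top)]
      exact ENNReal.mul_lt_top (lt_top_iff_ne_top.2 (ENNReal.pow_ne_top ENNReal.ofReal_ne_top)) ha2
    exact lintegral_enorm_sq_lt_top_of_norm_le hle h9
  have ifa : Integrable (fun x => frobeniusNormSq (fderiv ℝ a x)) volume :=
    integrable_of_continuous_of_nonneg (FluidPDE.continuous_frobeniusNormSq_fderiv ha1' one_ne_zero)
      (fun x => frobeniusNormSq_nonneg _) haF
  -- freeze the slice quantities
  obtain ⟨Xa, hXa⟩ : ∃ X : ℝ, X = ∫ x, frobeniusNormSq (fderiv ℝ a x) := ⟨_, rfl⟩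
  obtain ⟨Ya, hYa⟩ : ∃ Y : ℝ, Y = ∫ x, ‖(Δ a) x‖ ^ 2 := ⟨_, rfl⟩
  obtain ⟨X₁, hX₁⟩ : ∃ X : ℝ, X = ∫ x, frobeniusNormSq (fderiv ℝ w x) := ⟨_, rfl⟩
  rw [← hXa, ← hYa, ← hX₁]
  have hA0 : 0 ≤ A := hA.nonneg
  have hXa0 : 0 ≤ Xa := by rw [hXa]; exact integral_nonneg fun x => frobeniusNormSq_nonneg _
  have hYa0 : 0 ≤ Ya := by rw [hYa]; exact integral_nonneg fun x => sq_nonneg _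
  have hX₁0 : 0 ≤ X₁ := by rw [hX₁]; exact integral_nonneg fun x => frobeniusNormSq_nonneg _
  -- the two Cauchy–Schwarz cross inequalities
  have hcsaw : (∫ x, ‖fderiv ℝ a x‖ * ‖fderiv ℝ w x‖) ≤ Real.sqrt Xa * Real.sqrt X₁ := by
    rw [hXa, hX₁]; exact (r3rob_integral_opNorm_mul_le ha1' hw1' l2Da l2Dw haF hwF).2
  have iaw : Integrable (fun x => ‖fderiv ℝ a x‖ * ‖fderiv ℝ w x‖) volume :=
    (r3rob_integral_opNorm_mul_le ha1' hw1' l2Da l2Dw haF hwF).1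
  have hcsa0 : (∫ x, ‖fderiv ℝ a x‖ * ‖w x‖) ≤ Real.sqrt Xa * L := by
    have mDa : MemLp (fderiv ℝ a) 2 volume := r3rob_memLp_two cDa l2Da
    have mw : MemLp w 2 volume := r3rob_memLp_two cw hw0
    have h := integral_norm_mul_norm_le_sqrt_mul_sqrt mDa mw
    have hXop : Real.sqrt (∫ x, ‖fderiv ℝ a x‖ ^ 2) ≤ Real.sqrt Xa := by
      refine Real.sqrt_le_sqrt ?_
      rw [hXa]
      exact integral_mono (FluidPDE.integrable_sq_norm_of_lintegral_lt_top cDa l2Da) ifa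
        fun x => FluidPDE.sq_opNorm_le_frobeniusNormSq _
    exact h.trans (mul_le_mul hXop hL (Real.sqrt_nonneg _) (Real.sqrt_nonneg _ |>.trans hXop))
  have ia0 : Integrable (fun x => ‖fderiv ℝ a x‖ * ‖w x‖) volume :=
    integrable_of_norm_le_mul_of_lintegral_sq ((cDa.norm.mul cw.norm).aestronglyMeasurable) cDa cw
      l2Da hw0 (fun x => by rw [Real.norm_of_nonneg (mul_nonneg (norm_nonneg _) (norm_nonneg _))])
  -- `‖a‖_{L²} ≤ √X₁`
  have ha_l2 : Real.sqrt (∫ x, ‖a x‖ ^ 2) ≤ Real.sqrt X₁ := by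
    refine Real.sqrt_le_sqrt ?_
    rw [hX₁]
    have ifw : Integrable (fun x => frobeniusNormSq (fderiv ℝ w x)) volume :=
      integrable_of_continuous_of_nonneg (FluidPDE.continuous_frobeniusNormSq_fderiv hw1' one_ne_zero)
        (fun x => frobeniusNormSq_nonneg _) hwF
    refine integral_mono (FluidPDE.integrable_sq_norm_of_lintegral_lt_top ca ha0') ifw fun x => ?_
    exact (pow_le_pow_left₀ (norm_nonneg _) (na x) 2).trans (FluidPDE.sq_opNorm_le_frobeniusNormSq _)
  -- (a) transport by `u`: `∫⟪(u·∇)a, Δa⟫ ≤ G Xa`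
  have Pa : ∫ x, ⟪convect u a x, (Δ a) x⟫ ≤ G * Xa := by
    obtain ⟨iS, hid⟩ := integral_inner_laplacian_convect_left_eq_neg_sum hu ha hdivu hB hB₁ ha1 ha2
    have hcomm : ∫ x, ⟪convect u a x, (Δ a) x⟫ = ∫ x, ⟪(Δ a) x, convect u a x⟫ :=
      integral_congr_ae (Eventually.of_forall fun x => real_inner_comm _ _)
    rw [hcomm, hid, ← integral_neg, hXa, ← integral_const_mul]
    refine integral_mono iS.neg (ifa.const_mul G) fun x => ?_
    exact r3rob_neg_sum_inner_comp_le (fderiv ℝ u x) (fderiv ℝ a x) (hG x)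
  -- (b) transport by `w`: Cauchy–Schwarz with the sup of `w`
  have Pb : ∫ x, ⟪convect w a x, (Δ a) x⟫ ≤ Mw * Real.sqrt Xa * Real.sqrt Ya := by
    rw [hXa, hYa]; exact integral_inner_convect_le_of_norm_le ha1' cΔ hMw0 hMw haF hΔ2
  -- (c) stretching of `a` by `Du`
  have Pc : ∫ x, ⟪convect a u x, (Δ a) x⟫ ≤ G * Xa + 3 * σ₂ * Real.sqrt X₁ * Real.sqrt Xa := by
    obtain ⟨iS, iR, hid⟩ :=
      integral_inner_laplacian_convect_right_eq_neg_sum hu ha hB₁ hσ₂ ha0' ha1 ha2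
    have hcomm : ∫ x, ⟪convect a u x, (Δ a) x⟫ = ∫ x, ⟪(Δ a) x, convect a u x⟫ :=
      integral_congr_ae (Eventually.of_forall fun x => real_inner_comm _ _)
    rw [hcomm, hid]
    have h1 : -(∫ x, ∑ i, ⟪fderiv ℝ a x (e i), fderiv ℝ u x (fderiv ℝ a x (e i))⟫) ≤ G * Xa := by
      rw [← integral_neg, hXa, ← integral_const_mul]
      refine integral_mono iS.neg (ifa.const_mul G) fun x => ?_
      exact r3rob_neg_sum_inner_le (fderiv ℝ u x) (fderiv ℝ a x) (hG x)
    have h2 : -(∫ x, ∑ i, ⟪fderiv ℝ a x (e i), convect a (fun y => fderiv ℝ u y (e i)) x⟫) ≤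
        3 * σ₂ * Real.sqrt X₁ * Real.sqrt Xa := by
      have n_Dus : ∀ i x, ‖fderiv ℝ (fun y => fderiv ℝ u y (e i)) x‖ ≤ σ₂ := fun i x => by
        have h : ‖fderiv ℝ (fun y => fderiv ℝ u y (e i)) x‖ =
            ‖iteratedFDeriv ℝ 1 (fun y => fderiv ℝ u y (e i)) x‖ := by
          rw [← norm_iteratedFDeriv_fderiv, norm_iteratedFDeriv_zero]
        rw [h]
        exact (norm_iteratedFDeriv_fderiv_apply_basisFun_le hu 1 (by norm_cast) x i).trans (hσ₂ x)
      have hpt : ∀ x, -(∑ i, ⟪fderiv ℝ a x (e i), convect a (fun y => fderiv ℝ u y (e i)) x⟫) ≤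
          3 * σ₂ * (‖a x‖ * ‖fderiv ℝ a x‖) := by
        intro x
        have hi : ∀ i, -⟪fderiv ℝ a x (e i), convect a (fun y => fderiv ℝ u y (e i)) x⟫ ≤
            σ₂ * (‖a x‖ * ‖fderiv ℝ a x‖) := by
          intro i
          have hc : ‖convect a (fun y => fderiv ℝ u y (e i)) x‖ ≤ σ₂ * ‖a x‖ := by
            rw [convect]
            exact (fderiv ℝ (fun y => fderiv ℝ u y (e i)) x).le_of_opNorm_le (n_Dus i x) (a x)
          have hd : ‖fderiv ℝ a x (e i)‖ ≤ ‖fderiv ℝ a x‖ := by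
            simpa [he1] using (fderiv ℝ a x).le_opNorm (e i)
          calc -⟪fderiv ℝ a x (e i), convect a (fun y => fderiv ℝ u y (e i)) x⟫
              ≤ ‖fderiv ℝ a x (e i)‖ * ‖convect a (fun y => fderiv ℝ u y (e i)) x‖ :=
                (neg_le_abs _).trans (abs_real_inner_le_norm _ _)
            _ ≤ ‖fderiv ℝ a x‖ * (σ₂ * ‖a x‖) :=
                mul_le_mul hd hc (norm_nonneg _) (norm_nonneg _)
            _ = σ₂ * (‖a x‖ * ‖fderiv ℝ a x‖) := by ring
        rw [← Finset.sum_neg_distrib]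
        calc ∑ i, -⟪fderiv ℝ a x (e i), convect a (fun y => fderiv ℝ u y (e i)) x⟫
            ≤ ∑ _i : Fin 3, σ₂ * (‖a x‖ * ‖fderiv ℝ a x‖) := Finset.sum_le_sum fun i _ => hi i
          _ = 3 * σ₂ * (‖a x‖ * ‖fderiv ℝ a x‖) := by
              rw [Finset.sum_const, Finset.card_univ, Fintype.card_fin, nsmul_eq_mul]
              push_cast
              ring
      have ma : MemLp a 2 volume := r3rob_memLp_two ca ha0'
      have mDa : MemLp (fderiv ℝ a) 2 volume := r3rob_memLp_two cDa l2Da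
      have hcs := integral_norm_mul_norm_le_sqrt_mul_sqrt ma mDa
      have iprod : Integrable (fun x => ‖a x‖ * ‖fderiv ℝ a x‖) volume :=
        integrable_of_norm_le_mul_of_lintegral_sq ((ca.norm.mul cDa.norm).aestronglyMeasurable) ca cDa
          ha0' l2Da (fun x => by rw [Real.norm_of_nonneg (mul_nonneg (norm_nonneg _) (norm_nonneg _))])
      have hXop : Real.sqrt (∫ x, ‖fderiv ℝ a x‖ ^ 2) ≤ Real.sqrt Xa := by
        refine Real.sqrt_le_sqrt ?_
        rw [hXa]
        exact integral_mono (FluidPDE.integrable_sq_norm_of_lintegral_lt_top cDa l2Da) ifa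
          fun x => FluidPDE.sq_opNorm_le_frobeniusNormSq _
      rw [← integral_neg]
      calc ∫ x, -(∑ i, ⟪fderiv ℝ a x (e i), convect a (fun y => fderiv ℝ u y (e i)) x⟫)
          ≤ ∫ x, 3 * σ₂ * (‖a x‖ * ‖fderiv ℝ a x‖) := integral_mono iR.neg (iprod.const_mul _) hpt
        _ = 3 * σ₂ * ∫ x, ‖a x‖ * ‖fderiv ℝ a x‖ := integral_const_mul _ _
        _ ≤ 3 * σ₂ * (Real.sqrt (∫ x, ‖a x‖ ^ 2) * Real.sqrt (∫ x, ‖fderiv ℝ a x‖ ^ 2)) :=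
            mul_le_mul_of_nonneg_left hcs (by positivity)
        _ ≤ 3 * σ₂ * (Real.sqrt X₁ * Real.sqrt Xa) :=
            mul_le_mul_of_nonneg_left (mul_le_mul ha_l2 hXop (Real.sqrt_nonneg _)
              (Real.sqrt_nonneg _)) (by positivity)
        _ = 3 * σ₂ * Real.sqrt X₁ * Real.sqrt Xa := by ring
    linarith [h1, h2]
  -- (d) `∫⟪(w·∇)b, Δa⟫` by parts (three fields `a, w, b`)
  have Pd : ∫ x, ⟪convect w b x, (Δ a) x⟫ ≤
      3 * σ₂ * Real.sqrt X₁ * Real.sqrt Xa + 3 * σ₃ * L * Real.sqrt Xa := by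
    obtain ⟨iS, iR, hid⟩ :=
      r3rob_integral_inner_laplacian_convect3 ha hw hb hb1 hb2 hw0 l2Dw l2Da ha2
    have hcomm : ∫ x, ⟪convect w b x, (Δ a) x⟫ = ∫ x, ⟪(Δ a) x, convect w b x⟫ :=
      integral_congr_ae (Eventually.of_forall fun x => real_inner_comm _ _)
    rw [hcomm, hid]
    -- first sum: `|⟪∂ⱼa, Db(∂ⱼw)⟫| ≤ σ₂ ‖Da‖ ‖Dw‖`
    have h1 : -(∫ x, ∑ j, ⟪fderiv ℝ a x (e j), fderiv ℝ b x (fderiv ℝ w x (e j))⟫) ≤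
        3 * σ₂ * Real.sqrt X₁ * Real.sqrt Xa := by
      have hpt : ∀ x, -(∑ j, ⟪fderiv ℝ a x (e j), fderiv ℝ b x (fderiv ℝ w x (e j))⟫) ≤
          3 * σ₂ * (‖fderiv ℝ a x‖ * ‖fderiv ℝ w x‖) := by
        intro x
        have hi : ∀ j, -⟪fderiv ℝ a x (e j), fderiv ℝ b x (fderiv ℝ w x (e j))⟫ ≤
            σ₂ * (‖fderiv ℝ a x‖ * ‖fderiv ℝ w x‖) := by
          intro j
          have hd : ‖fderiv ℝ a x (e j)‖ ≤ ‖fderiv ℝ a x‖ := by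
            simpa [he1] using (fderiv ℝ a x).le_opNorm (e j)
          have hc : ‖fderiv ℝ b x (fderiv ℝ w x (e j))‖ ≤ σ₂ * ‖fderiv ℝ w x‖ := by
            refine ((fderiv ℝ b x).le_of_opNorm_le (hb1 x) _).trans ?_
            exact mul_le_mul_of_nonneg_left (by simpa [he1] using (fderiv ℝ w x).le_opNorm (e j))
              hσ₂0
          calc -⟪fderiv ℝ a x (e j), fderiv ℝ b x (fderiv ℝ w x (e j))⟫
              ≤ ‖fderiv ℝ a x (e j)‖ * ‖fderiv ℝ b x (fderiv ℝ w x (e j))‖ :=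
                (neg_le_abs _).trans (abs_real_inner_le_norm _ _)
            _ ≤ ‖fderiv ℝ a x‖ * (σ₂ * ‖fderiv ℝ w x‖) :=
                mul_le_mul hd hc (norm_nonneg _) (norm_nonneg _)
            _ = σ₂ * (‖fderiv ℝ a x‖ * ‖fderiv ℝ w x‖) := by ring
        rw [← Finset.sum_neg_distrib]
        calc ∑ j, -⟪fderiv ℝ a x (e j), fderiv ℝ b x (fderiv ℝ w x (e j))⟫
            ≤ ∑ _j : Fin 3, σ₂ * (‖fderiv ℝ a x‖ * ‖fderiv ℝ w x‖) :=
              Finset.sum_le_sum fun j _ => hi j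
          _ = 3 * σ₂ * (‖fderiv ℝ a x‖ * ‖fderiv ℝ w x‖) := by
              rw [Finset.sum_const, Finset.card_univ, Fintype.card_fin, nsmul_eq_mul]
              push_cast
              ring
      rw [← integral_neg]
      calc ∫ x, -(∑ j, ⟪fderiv ℝ a x (e j), fderiv ℝ b x (fderiv ℝ w x (e j))⟫)
          ≤ ∫ x, 3 * σ₂ * (‖fderiv ℝ a x‖ * ‖fderiv ℝ w x‖) :=
            integral_mono iS.neg (iaw.const_mul _) hpt
        _ = 3 * σ₂ * ∫ x, ‖fderiv ℝ a x‖ * ‖fderiv ℝ w x‖ := integral_const_mul _ _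
        _ ≤ 3 * σ₂ * (Real.sqrt Xa * Real.sqrt X₁) := mul_le_mul_of_nonneg_left hcsaw (by positivity)
        _ = 3 * σ₂ * Real.sqrt X₁ * Real.sqrt Xa := by ring
    -- second sum: `|⟪∂ⱼa, (w·∇)∂ⱼb⟫| ≤ σ₃ ‖Da‖ ‖w‖`
    have h2 : -(∫ x, ∑ j, ⟪fderiv ℝ a x (e j), convect w (fun y => fderiv ℝ b y (e j)) x⟫) ≤
        3 * σ₃ * L * Real.sqrt Xa := by
      have n_Dbs : ∀ j x, ‖fderiv ℝ (fun y => fderiv ℝ b y (e j)) x‖ ≤ σ₃ := fun j x => by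
        have h : ‖fderiv ℝ (fun y => fderiv ℝ b y (e j)) x‖ =
            ‖iteratedFDeriv ℝ 1 (fun y => fderiv ℝ b y (e j)) x‖ := by
          rw [← norm_iteratedFDeriv_fderiv, norm_iteratedFDeriv_zero]
        rw [h]
        exact (norm_iteratedFDeriv_fderiv_apply_basisFun_le hb 1 (by norm_cast) x j).trans (hb2 x)
      have hpt : ∀ x, -(∑ j, ⟪fderiv ℝ a x (e j), convect w (fun y => fderiv ℝ b y (e j)) x⟫) ≤
          3 * σ₃ * (‖fderiv ℝ a x‖ * ‖w x‖) := by
        intro x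
        have hi : ∀ j, -⟪fderiv ℝ a x (e j), convect w (fun y => fderiv ℝ b y (e j)) x⟫ ≤
            σ₃ * (‖fderiv ℝ a x‖ * ‖w x‖) := by
          intro j
          have hd : ‖fderiv ℝ a x (e j)‖ ≤ ‖fderiv ℝ a x‖ := by
            simpa [he1] using (fderiv ℝ a x).le_opNorm (e j)
          have hc : ‖convect w (fun y => fderiv ℝ b y (e j)) x‖ ≤ σ₃ * ‖w x‖ := by
            rw [convect]
            exact (fderiv ℝ (fun y => fderiv ℝ b y (e j)) x).le_of_opNorm_le (n_Dbs j x) (w x)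
          calc -⟪fderiv ℝ a x (e j), convect w (fun y => fderiv ℝ b y (e j)) x⟫
              ≤ ‖fderiv ℝ a x (e j)‖ * ‖convect w (fun y => fderiv ℝ b y (e j)) x‖ :=
                (neg_le_abs _).trans (abs_real_inner_le_norm _ _)
            _ ≤ ‖fderiv ℝ a x‖ * (σ₃ * ‖w x‖) := mul_le_mul hd hc (norm_nonneg _) (norm_nonneg _)
            _ = σ₃ * (‖fderiv ℝ a x‖ * ‖w x‖) := by ring
        rw [← Finset.sum_neg_distrib]
        calc ∑ j, -⟪fderiv ℝ a x (e j), convect w (fun y => fderiv ℝ b y (e j)) x⟫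
            ≤ ∑ _j : Fin 3, σ₃ * (‖fderiv ℝ a x‖ * ‖w x‖) := Finset.sum_le_sum fun j _ => hi j
          _ = 3 * σ₃ * (‖fderiv ℝ a x‖ * ‖w x‖) := by
              rw [Finset.sum_const, Finset.card_univ, Fintype.card_fin, nsmul_eq_mul]
              push_cast
              ring
      rw [← integral_neg]
      calc ∫ x, -(∑ j, ⟪fderiv ℝ a x (e j), convect w (fun y => fderiv ℝ b y (e j)) x⟫)
          ≤ ∫ x, 3 * σ₃ * (‖fderiv ℝ a x‖ * ‖w x‖) := integral_mono iR.neg (ia0.const_mul _) hpt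
        _ = 3 * σ₃ * ∫ x, ‖fderiv ℝ a x‖ * ‖w x‖ := integral_const_mul _ _
        _ ≤ 3 * σ₃ * (Real.sqrt Xa * L) := mul_le_mul_of_nonneg_left hcsa0 (by positivity)
        _ = 3 * σ₃ * L * Real.sqrt Xa := by ring
    linarith [h1, h2]
  -- (e) `∫⟪Dw(b), Δa⟫` by parts (three fields `a, b, w`): the first sum is a cross term, the
  -- second is handed to the caller
  obtain ⟨iSe, iRe, hide⟩ :=
    r3rob_integral_inner_laplacian_convect3 ha hb hw hBw₁ hBw₂ hbl0 hbl1 l2Da ha2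
  have Pe : (∫ x, ⟪fderiv ℝ w x (b x), (Δ a) x⟫) +
      ∫ x, ∑ j, ⟪fderiv ℝ a x (e j), convect b (fun y => fderiv ℝ w y (e j)) x⟫ ≤
      3 * σ₂ * Real.sqrt X₁ * Real.sqrt Xa := by
    have hcomm : ∫ x, ⟪fderiv ℝ w x (b x), (Δ a) x⟫ = ∫ x, ⟪(Δ a) x, convect b w x⟫ :=
      integral_congr_ae (Eventually.of_forall fun x => real_inner_comm _ _)
    rw [hcomm, hide]
    have h1 : -(∫ x, ∑ j, ⟪fderiv ℝ a x (e j), fderiv ℝ w x (fderiv ℝ b x (e j))⟫) ≤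
        3 * σ₂ * Real.sqrt X₁ * Real.sqrt Xa := by
      have hpt : ∀ x, -(∑ j, ⟪fderiv ℝ a x (e j), fderiv ℝ w x (fderiv ℝ b x (e j))⟫) ≤
          3 * σ₂ * (‖fderiv ℝ a x‖ * ‖fderiv ℝ w x‖) := by
        intro x
        have hi : ∀ j, -⟪fderiv ℝ a x (e j), fderiv ℝ w x (fderiv ℝ b x (e j))⟫ ≤
            σ₂ * (‖fderiv ℝ a x‖ * ‖fderiv ℝ w x‖) := by
          intro j
          have hd : ‖fderiv ℝ a x (e j)‖ ≤ ‖fderiv ℝ a x‖ := by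
            simpa [he1] using (fderiv ℝ a x).le_opNorm (e j)
          have hbj : ‖fderiv ℝ b x (e j)‖ ≤ σ₂ := by
            have := (fderiv ℝ b x).le_opNorm (e j)
            rw [he1, mul_one] at this
            exact this.trans (hb1 x)
          have hc : ‖fderiv ℝ w x (fderiv ℝ b x (e j))‖ ≤ ‖fderiv ℝ w x‖ * σ₂ :=
            ((fderiv ℝ w x).le_opNorm _).trans (mul_le_mul_of_nonneg_left hbj (norm_nonneg _))
          calc -⟪fderiv ℝ a x (e j), fderiv ℝ w x (fderiv ℝ b x (e j))⟫
              ≤ ‖fderiv ℝ a x (e j)‖ * ‖fderiv ℝ w x (fderiv ℝ b x (e j))‖ :=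
                (neg_le_abs _).trans (abs_real_inner_le_norm _ _)
            _ ≤ ‖fderiv ℝ a x‖ * (‖fderiv ℝ w x‖ * σ₂) :=
                mul_le_mul hd hc (norm_nonneg _) (norm_nonneg _)
            _ = σ₂ * (‖fderiv ℝ a x‖ * ‖fderiv ℝ w x‖) := by ring
        rw [← Finset.sum_neg_distrib]
        calc ∑ j, -⟪fderiv ℝ a x (e j), fderiv ℝ w x (fderiv ℝ b x (e j))⟫
            ≤ ∑ _j : Fin 3, σ₂ * (‖fderiv ℝ a x‖ * ‖fderiv ℝ w x‖) :=
              Finset.sum_le_sum fun j _ => hi j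
          _ = 3 * σ₂ * (‖fderiv ℝ a x‖ * ‖fderiv ℝ w x‖) := by
              rw [Finset.sum_const, Finset.card_univ, Fintype.card_fin, nsmul_eq_mul]
              push_cast
              ring
      rw [← integral_neg]
      calc ∫ x, -(∑ j, ⟪fderiv ℝ a x (e j), fderiv ℝ w x (fderiv ℝ b x (e j))⟫)
          ≤ ∫ x, 3 * σ₂ * (‖fderiv ℝ a x‖ * ‖fderiv ℝ w x‖) :=
            integral_mono iSe.neg (iaw.const_mul _) hpt
        _ = 3 * σ₂ * ∫ x, ‖fderiv ℝ a x‖ * ‖fderiv ℝ w x‖ := integral_const_mul _ _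
        _ ≤ 3 * σ₂ * (Real.sqrt Xa * Real.sqrt X₁) := mul_le_mul_of_nonneg_left hcsaw (by positivity)
        _ = 3 * σ₂ * Real.sqrt X₁ * Real.sqrt Xa := by ring
    linarith [h1]
  -- (f) `∫⟪Dw(a), Δa⟫`: Cauchy–Schwarz with the sup of `a` (Agmon for `a`)
  obtain ⟨Ma, hMa⟩ : ∃ M : ℝ, M = A * (Xa * Ya) ^ (1 / 4 : ℝ) := ⟨_, rfl⟩
  have hMa0 : 0 ≤ Ma := by
    rw [hMa]; exact mul_nonneg hA0 (Real.rpow_nonneg (mul_nonneg hXa0 hYa0) _)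
  have hMax : ∀ x, ‖a x‖ ≤ Ma := fun x => by
    rw [hMa, hXa, hYa]
    exact hA.norm_le ha han x
  have Pf : ∫ x, ⟪fderiv ℝ w x (a x), (Δ a) x⟫ ≤ Ma * Real.sqrt X₁ * Real.sqrt Ya := by
    rw [hX₁, hYa]
    exact integral_inner_convect_le_of_norm_le hw1' cΔ hMa0 hMax hwF hΔ2
  -- integrability of the six pairings and the split of the sum
  have l2N : ∀ {N : EuclideanSpace ℝ (Fin 3) → EuclideanSpace ℝ (Fin 3)}, Continuous N →
      (∫⁻ x, ‖N x‖ₑ ^ 2 < ⊤) → Integrable (fun x => ⟪N x, (Δ a) x⟫) volume := fun cN hN =>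
    integrable_of_norm_le_mul_of_lintegral_sq (cN.inner cΔ).aestronglyMeasurable cN cΔ hN hΔ2
      fun x => norm_inner_le_norm _ _
  have hB0 : 0 ≤ B := (norm_nonneg _).trans (hB 0)
  have hB₁0 : 0 ≤ B₁ := (norm_nonneg _).trans (hB₁ 0)
  have hBw₁0 : 0 ≤ Bw₁ := (norm_nonneg _).trans (hBw₁ 0)
  have ia : Integrable (fun x => ⟪convect u a x, (Δ a) x⟫) volume :=
    integrable_inner_convect_of_norm_le cu ha1' cΔ hB0 hB haF hΔ2
  have ib : Integrable (fun x => ⟪convect w a x, (Δ a) x⟫) volume :=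
    integrable_inner_convect_of_norm_le cw ha1' cΔ hMw0 hMw haF hΔ2
  have ic : Integrable (fun x => ⟪convect a u x, (Δ a) x⟫) volume := by
    have n : ∀ x, ‖convect a u x‖ ≤ ‖B₁ * ‖a x‖‖ := fun x => by
      rw [convect, Real.norm_of_nonneg (mul_nonneg hB₁0 (norm_nonneg _))]
      exact (fderiv ℝ u x).le_of_opNorm_le (hB₁ x) (a x)
    exact l2N ((hu1'.continuous_fderiv one_ne_zero).clm_apply ca)
      (lintegral_enorm_sq_lt_top_of_norm_le n (r3rob_lintegral_sq_mul_norm_lt_top B₁ ha0'))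
  have id' : Integrable (fun x => ⟪convect w b x, (Δ a) x⟫) volume := by
    have n : ∀ x, ‖convect w b x‖ ≤ ‖σ₂ * ‖w x‖‖ := fun x => by
      rw [convect, Real.norm_of_nonneg (mul_nonneg hσ₂0 (norm_nonneg _))]
      exact (fderiv ℝ b x).le_of_opNorm_le (hb1 x) (w x)
    exact l2N (cDb.clm_apply cw)
      (lintegral_enorm_sq_lt_top_of_norm_le n (r3rob_lintegral_sq_mul_norm_lt_top σ₂ hw0))
  have ie : Integrable (fun x => ⟪fderiv ℝ w x (b x), (Δ a) x⟫) volume := by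
    have n : ∀ x, ‖fderiv ℝ w x (b x)‖ ≤ ‖Bw₁ * ‖b x‖‖ := fun x => by
      rw [Real.norm_of_nonneg (mul_nonneg hBw₁0 (norm_nonneg _))]
      exact (fderiv ℝ w x).le_of_opNorm_le (hBw₁ x) (b x)
    exact l2N (cDw.clm_apply cb)
      (lintegral_enorm_sq_lt_top_of_norm_le n (r3rob_lintegral_sq_mul_norm_lt_top Bw₁ hbl0))
  have if' : Integrable (fun x => ⟪fderiv ℝ w x (a x), (Δ a) x⟫) volume := by
    have n : ∀ x, ‖fderiv ℝ w x (a x)‖ ≤ ‖Bw₁ * ‖a x‖‖ := fun x => by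
      rw [Real.norm_of_nonneg (mul_nonneg hBw₁0 (norm_nonneg _))]
      exact (fderiv ℝ w x).le_of_opNorm_le (hBw₁ x) (a x)
    exact l2N (cDw.clm_apply ca)
      (lintegral_enorm_sq_lt_top_of_norm_le n (r3rob_lintegral_sq_mul_norm_lt_top Bw₁ ha0'))
  have hsum : ∫ x, ⟪convect u a x + convect w a x + convect a u x + convect w b x +
        fderiv ℝ w x (b x) + fderiv ℝ w x (a x), (Δ a) x⟫ =
      (∫ x, ⟪convect u a x, (Δ a) x⟫) + (∫ x, ⟪convect w a x, (Δ a) x⟫) +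
        (∫ x, ⟪convect a u x, (Δ a) x⟫) + (∫ x, ⟪convect w b x, (Δ a) x⟫) +
        (∫ x, ⟪fderiv ℝ w x (b x), (Δ a) x⟫) + ∫ x, ⟪fderiv ℝ w x (a x), (Δ a) x⟫ := by
    have eq : ∀ x, ⟪convect u a x + convect w a x + convect a u x + convect w b x +
        fderiv ℝ w x (b x) + fderiv ℝ w x (a x), (Δ a) x⟫ =
        ⟪convect u a x, (Δ a) x⟫ + ⟪convect w a x, (Δ a) x⟫ + ⟪convect a u x, (Δ a) x⟫ +
          ⟪convect w b x, (Δ a) x⟫ + ⟪fderiv ℝ w x (b x), (Δ a) x⟫ +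
          ⟪fderiv ℝ w x (a x), (Δ a) x⟫ := fun x => by
      simp only [inner_add_left]
    simp_rw [eq]
    have i12 : Integrable (fun x => ⟪convect u a x, (Δ a) x⟫ + ⟪convect w a x, (Δ a) x⟫) volume :=
      ia.add ib
    have i123 : Integrable (fun x => ⟪convect u a x, (Δ a) x⟫ + ⟪convect w a x, (Δ a) x⟫ +
        ⟪convect a u x, (Δ a) x⟫) volume := i12.add ic
    have i1234 : Integrable (fun x => ⟪convect u a x, (Δ a) x⟫ + ⟪convect w a x, (Δ a) x⟫ +
        ⟪convect a u x, (Δ a) x⟫ + ⟪convect w b x, (Δ a) x⟫) volume := i123.add id'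
    have i12345 : Integrable (fun x => ⟪convect u a x, (Δ a) x⟫ + ⟪convect w a x, (Δ a) x⟫ +
        ⟪convect a u x, (Δ a) x⟫ + ⟪convect w b x, (Δ a) x⟫ + ⟪fderiv ℝ w x (b x), (Δ a) x⟫)
        volume := i1234.add ie
    rw [integral_add i12345 if', integral_add i1234 ie, integral_add i123 id', integral_add i12 ic,
      integral_add ia ib]
  refine ⟨iRe, ?_⟩
  rw [hsum]
  have hMa' : Ma = A * (Xa * Ya) ^ (1 / 4 : ℝ) := hMa
  rw [← hMa']
  linarith [Pa, Pb, Pc, Pd, Pe, Pf]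

/-- **The symmetric Hessian term**: with `wᵢ = ∂ᵢw`, `uᵢ = ∂ᵢu`,
`−Σᵢ∫Σⱼ⟪∂ⱼwᵢ, D(∂ⱼw)(uᵢ)⟫ = −∫ΣⱼΣᵢ⟪∂ᵢwⱼ, Dwⱼ(Du eᵢ)⟫ ≤ G·Σⱼ∫|∇wⱼ|²_F` (Schwarz `∂ⱼwᵢ = ∂ᵢwⱼ`,
then the quadratic form of §4b column by column). [folklore] -/
private theorem r3rob_H2_symmetric_le {u w : EuclideanSpace ℝ (Fin 3) → EuclideanSpace ℝ (Fin 3)}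
    (hw : ContDiff ℝ ∞ w) {G : ℝ}
    (hG : ∀ x (ξ : EuclideanSpace ℝ (Fin 3)), -⟪fderiv ℝ u x ξ, ξ⟫ ≤ G * ‖ξ‖ ^ 2)
    (hI : ∀ i, Integrable (fun x => ∑ j,
      ⟪fderiv ℝ (fun y => fderiv ℝ w y (EuclideanSpace.basisFun (Fin 3) ℝ i)) x
          (EuclideanSpace.basisFun (Fin 3) ℝ j),
        convect (fun y => fderiv ℝ u y (EuclideanSpace.basisFun (Fin 3) ℝ i))
          (fun y => fderiv ℝ w y (EuclideanSpace.basisFun (Fin 3) ℝ j)) x⟫) volume)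
    (hF : ∀ j, Integrable (fun x => frobeniusNormSq
      (fderiv ℝ (fun y => fderiv ℝ w y (EuclideanSpace.basisFun (Fin 3) ℝ j)) x)) volume) :
    -(∑ i, ∫ x, ∑ j,
      ⟪fderiv ℝ (fun y => fderiv ℝ w y (EuclideanSpace.basisFun (Fin 3) ℝ i)) x
          (EuclideanSpace.basisFun (Fin 3) ℝ j),
        convect (fun y => fderiv ℝ u y (EuclideanSpace.basisFun (Fin 3) ℝ i))
          (fun y => fderiv ℝ w y (EuclideanSpace.basisFun (Fin 3) ℝ j)) x⟫) ≤
      G * ∑ j, ∫ x, frobeniusNormSq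
        (fderiv ℝ (fun y => fderiv ℝ w y (EuclideanSpace.basisFun (Fin 3) ℝ j)) x) := by
  set e := EuclideanSpace.basisFun (Fin 3) ℝ with he
  have hw2 : ContDiff ℝ 2 w := hw.of_le (by norm_cast)
  -- pointwise: swap the indices by Schwarz and bound column by column
  have hpt : ∀ x, -(∑ i, ∑ j, ⟪fderiv ℝ (fun y => fderiv ℝ w y (e i)) x (e j),
      convect (fun y => fderiv ℝ u y (e i)) (fun y => fderiv ℝ w y (e j)) x⟫) ≤
      ∑ j, G * frobeniusNormSq (fderiv ℝ (fun y => fderiv ℝ w y (e j)) x) := by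
    intro x
    have hswap : ∑ i, ∑ j, ⟪fderiv ℝ (fun y => fderiv ℝ w y (e i)) x (e j),
        convect (fun y => fderiv ℝ u y (e i)) (fun y => fderiv ℝ w y (e j)) x⟫ =
        ∑ j, ∑ i, ⟪fderiv ℝ (fun y => fderiv ℝ w y (e j)) x (e i),
          fderiv ℝ (fun y => fderiv ℝ w y (e j)) x (fderiv ℝ u x (e i))⟫ := by
      rw [Finset.sum_comm]
      refine Finset.sum_congr rfl fun j _ => Finset.sum_congr rfl fun i _ => ?_
      rw [fderiv_fderiv_apply_comm_of_contDiff_two hw2 x (e i) (e j), convect]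
    rw [hswap, ← Finset.sum_neg_distrib]
    exact Finset.sum_le_sum fun j _ =>
      r3rob_neg_sum_inner_comp_le (fderiv ℝ u x) (fderiv ℝ (fun y => fderiv ℝ w y (e j)) x) (hG x)
  rw [← integral_finsetSum _ fun i _ => hI i, ← integral_neg, Finset.mul_sum]
  have hR : ∑ j, G * ∫ x, frobeniusNormSq (fderiv ℝ (fun y => fderiv ℝ w y (e j)) x) =
      ∫ x, ∑ j, G * frobeniusNormSq (fderiv ℝ (fun y => fderiv ℝ w y (e j)) x) := by
    rw [integral_finsetSum _ fun j _ => (hF j).const_mul G]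
    exact Finset.sum_congr rfl fun j _ => (integral_const_mul _ _).symm
  rw [hR]
  exact integral_mono (integrable_finsetSum _ fun i _ => hI i).neg
    (integrable_finsetSum _ fun j _ => (hF j).const_mul G) fun x => hpt x

/-- Scalar bookkeeping for the sum over the three directions. [folklore] -/
private theorem r3rob_H2_sum3 {ν G κ σ₂ σ₃ A X₁ Y₂ L H₁ Y0 Y1 Y2 X0 X1 X2 P0 P1 P2 F0 F1 F2
    S0 S1 S2 : ℝ}
    (k0 : -(2 * ν * Y0) + 2 * P0 + 2 * F0 + 2 * S0 ≤
      (4 * G + 9 * κ * σ₂ + 3 * κ ^ 2 * σ₃ + 2 * A ^ 2 * Real.sqrt (X₁ * Y₂) / ν +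
          27 * A ^ 4 * X₁ ^ 2 / (16 * ν ^ 3)) * X0 +
        9 * σ₂ / κ * X₁ + 3 * σ₃ / κ ^ 2 * L ^ 2 + 2 / ν * H₁)
    (k1 : -(2 * ν * Y1) + 2 * P1 + 2 * F1 + 2 * S1 ≤
      (4 * G + 9 * κ * σ₂ + 3 * κ ^ 2 * σ₃ + 2 * A ^ 2 * Real.sqrt (X₁ * Y₂) / ν +
          27 * A ^ 4 * X₁ ^ 2 / (16 * ν ^ 3)) * X1 +
        9 * σ₂ / κ * X₁ + 3 * σ₃ / κ ^ 2 * L ^ 2 + 2 / ν * H₁)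
    (k2 : -(2 * ν * Y2) + 2 * P2 + 2 * F2 + 2 * S2 ≤
      (4 * G + 9 * κ * σ₂ + 3 * κ ^ 2 * σ₃ + 2 * A ^ 2 * Real.sqrt (X₁ * Y₂) / ν +
          27 * A ^ 4 * X₁ ^ 2 / (16 * ν ^ 3)) * X2 +
        9 * σ₂ / κ * X₁ + 3 * σ₃ / κ ^ 2 * L ^ 2 + 2 / ν * H₁)
    (hsym : -(S0 + S1 + S2) ≤ G * (X0 + X1 + X2)) :
    -(2 * ν * Y0) + 2 * P0 + 2 * F0 + (-(2 * ν * Y1) + 2 * P1 + 2 * F1) +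
        (-(2 * ν * Y2) + 2 * P2 + 2 * F2) ≤
      (6 * G + 9 * κ * σ₂ + 3 * κ ^ 2 * σ₃ + 2 * A ^ 2 * Real.sqrt (X₁ * Y₂) / ν +
            27 * A ^ 4 * X₁ ^ 2 / (16 * ν ^ 3)) * (X0 + X1 + X2) +
        27 * σ₂ / κ * X₁ + 9 * σ₃ / κ ^ 2 * L ^ 2 + 6 / ν * H₁ := by
  have hid : (6 * G + 9 * κ * σ₂ + 3 * κ ^ 2 * σ₃ + 2 * A ^ 2 * Real.sqrt (X₁ * Y₂) / ν +
        27 * A ^ 4 * X₁ ^ 2 / (16 * ν ^ 3)) * (X0 + X1 + X2) +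
        27 * σ₂ / κ * X₁ + 9 * σ₃ / κ ^ 2 * L ^ 2 + 6 / ν * H₁ =
      ((4 * G + 9 * κ * σ₂ + 3 * κ ^ 2 * σ₃ + 2 * A ^ 2 * Real.sqrt (X₁ * Y₂) / ν +
          27 * A ^ 4 * X₁ ^ 2 / (16 * ν ^ 3)) * X0 +
        9 * σ₂ / κ * X₁ + 3 * σ₃ / κ ^ 2 * L ^ 2 + 2 / ν * H₁) +
      ((4 * G + 9 * κ * σ₂ + 3 * κ ^ 2 * σ₃ + 2 * A ^ 2 * Real.sqrt (X₁ * Y₂) / ν +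
          27 * A ^ 4 * X₁ ^ 2 / (16 * ν ^ 3)) * X1 +
        9 * σ₂ / κ * X₁ + 3 * σ₃ / κ ^ 2 * L ^ 2 + 2 / ν * H₁) +
      ((4 * G + 9 * κ * σ₂ + 3 * κ ^ 2 * σ₃ + 2 * A ^ 2 * Real.sqrt (X₁ * Y₂) / ν +
          27 * A ^ 4 * X₁ ^ 2 / (16 * ν ^ 3)) * X2 +
        9 * σ₂ / κ * X₁ + 3 * σ₃ / κ ^ 2 * L ^ 2 + 2 / ν * H₁) +
      2 * (G * (X0 + X1 + X2)) := by
    ring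
  rw [hid]
  linarith [k0, k1, k2, hsym]

/-- **The `H²`-level slice inequality in STRAIN form, explicit constants (Dashti–Robinson 2008,
proof of Thm 2 — the second-order robustness estimate `d/dt‖w‖₂ ≤ (c + c′)‖u‖₃‖w‖₂ + …` — with
Kato's inequalities `|(B(w,u), A²w)|, |(B(u,w), A²w)| ≤ c‖u‖₃‖w‖₂²` replaced by integrations by
parts onto quadratic forms in `Du` and sup majorants of `D²u, D³u`).** Let `u, w : ℝ³ → ℝ³` be
`C^∞`, `div u = 0`, `u, Du, Dw, D²w` bounded, `Du, D²u ∈ L²`, `w, …, D⁴w ∈ L²`, `h ∈ C¹` with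
`Dh ∈ L²`; write `wᵢ = ∂ᵢw`, `N = (v·∇)w + (w·∇)u` (`v = u + w`), `Z = Σᵢ∫|∇wᵢ|²_F` (`= ∫|D²w|²_F`),
`Y₃ = Σᵢ∫‖Δwᵢ‖²`, `X₁ = ∫|∇w|²_F`, `Y₂ = ∫‖Δw‖²`, `H₁ = ∫‖Dh‖²`, `A = agmonConst`, and suppose
`−⟪Du ξ, ξ⟫ ≤ G‖ξ‖²`, `‖D²u‖ ≤ σ₂`, `‖D³u‖ ≤ σ₃`, `‖w‖_{L²} ≤ L`, `κ > 0`. Then the `H²` flux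
`Σᵢ [−2ν∫‖Δwᵢ‖² + 2∫⟪∂ᵢN, Δwᵢ⟫ + 2∫⟪∂ᵢh, Δwᵢ⟫]` is at most
`(6G + 9κσ₂ + 3κ²σ₃ + 2A²√(X₁Y₂)/ν + 27A⁴X₁²/(16ν³))·Z + (27σ₂/κ)X₁ + (9σ₃/κ²)L² + (6/ν)H₁`:
linear in `Z` given the `H¹` level (`X₁`, bounded by `classicalNS_robustness_strain_R3`) except
through the transport-by-`w` coefficient `2A²√(X₁Y₂)/ν` (`Y₂ ≤ 3Z`; Agmon `‖w‖_∞ ≤ A(X₁Y₂)^{1/4}`),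
which makes the `H²` inequality of Riccati type `Z' ≲ λZ + βZ^{3/2}` as in the printed
`dy/dt ≤ δ + αy³` for `y = ‖w‖_{H²}` (the tree's `ForcedPowerComparison` closes such inequalities).
The six pairings per direction are `r3rob_H2_pairings`; the sup of `u` never enters.
[cite: DashtiRobinson2008, Thm 2 (proof); RobinsonRodrigoSadowskiCUP2016, Thm 9.1 (proof, Step 1)] -/
theorem robustness_flux_H2_le_strain_of_agmonBound {A : ℝ} (hA : AgmonBoundR3 A) {ν : ℝ} (hν : 0 < ν)
    {u w h : EuclideanSpace ℝ (Fin 3) → EuclideanSpace ℝ (Fin 3)} (hu : ContDiff ℝ ∞ u)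
    (hw : ContDiff ℝ ∞ w) (hh : ContDiff ℝ 1 h) (hdivu : VectorCalculus.IsDivFree u)
    (hwn : ∀ n : ℕ, ∫⁻ x, ‖iteratedFDeriv ℝ n w x‖ₑ ^ 2 < ⊤) (hh1 : ∫⁻ x, ‖fderiv ℝ h x‖ₑ ^ 2 < ⊤)
    {B : ℝ} (hB : ∀ x, ‖u x‖ ≤ B) {B₁ : ℝ} (hB₁ : ∀ x, ‖fderiv ℝ u x‖ ≤ B₁)
    (hu1 : ∫⁻ x, ‖iteratedFDeriv ℝ 1 u x‖ₑ ^ 2 < ⊤) (hu2 : ∫⁻ x, ‖iteratedFDeriv ℝ 2 u x‖ₑ ^ 2 < ⊤)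
    {Bw₁ : ℝ} (hBw₁ : ∀ x, ‖fderiv ℝ w x‖ ≤ Bw₁)
    {Bw₂ : ℝ} (hBw₂ : ∀ x, ‖iteratedFDeriv ℝ 2 w x‖ ≤ Bw₂)
    {G : ℝ} (hG : ∀ x (ξ : EuclideanSpace ℝ (Fin 3)), -⟪fderiv ℝ u x ξ, ξ⟫ ≤ G * ‖ξ‖ ^ 2)
    {σ₂ : ℝ} (hσ₂ : ∀ x, ‖iteratedFDeriv ℝ 2 u x‖ ≤ σ₂)
    {σ₃ : ℝ} (hσ₃ : ∀ x, ‖iteratedFDeriv ℝ 3 u x‖ ≤ σ₃)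
    {L : ℝ} (hL : Real.sqrt (∫ x, ‖w x‖ ^ 2) ≤ L) {κ : ℝ} (hκ : 0 < κ) :
    ∑ i, (-(2 * ν * ∫ x, ‖(Δ (fun y => fderiv ℝ w y (EuclideanSpace.basisFun (Fin 3) ℝ i))) x‖ ^ 2) +
        2 * (∫ x, ⟪fderiv ℝ (fun y => convect (fun z => u z + w z) w y + convect w u y) x
            (EuclideanSpace.basisFun (Fin 3) ℝ i),
          (Δ (fun y => fderiv ℝ w y (EuclideanSpace.basisFun (Fin 3) ℝ i))) x⟫) +
        2 * (∫ x, ⟪fderiv ℝ h x (EuclideanSpace.basisFun (Fin 3) ℝ i),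
          (Δ (fun y => fderiv ℝ w y (EuclideanSpace.basisFun (Fin 3) ℝ i))) x⟫)) ≤
      (6 * G + 9 * κ * σ₂ + 3 * κ ^ 2 * σ₃ +
            2 * A ^ 2 *
              Real.sqrt ((∫ x, frobeniusNormSq (fderiv ℝ w x)) * (∫ x, ‖(Δ w) x‖ ^ 2)) / ν +
            27 * A ^ 4 * (∫ x, frobeniusNormSq (fderiv ℝ w x)) ^ 2 / (16 * ν ^ 3)) *
          (∑ i, ∫ x, frobeniusNormSq
            (fderiv ℝ (fun y => fderiv ℝ w y (EuclideanSpace.basisFun (Fin 3) ℝ i)) x)) +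
        27 * σ₂ / κ * (∫ x, frobeniusNormSq (fderiv ℝ w x)) + 9 * σ₃ / κ ^ 2 * L ^ 2 +
        6 / ν * (∫ x, ‖fderiv ℝ h x‖ ^ 2) := by
  have hw0 := hwn 0
  have hw1 := hwn 1
  have hw2 := hwn 2
  have hw3 := hwn 3
  have hw4 := hwn 4
  set e := EuclideanSpace.basisFun (Fin 3) ℝ with he
  have he1 : ∀ i, ‖e i‖ = 1 := fun i => by simp [he]
  -- regularity basics
  have hw1' : ContDiff ℝ 1 w := hw.of_le (by norm_cast)
  have hu1' : ContDiff ℝ 1 u := hu.of_le (by norm_cast)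
  have cw : Continuous w := hw.continuous
  have cu : Continuous u := hu.continuous
  have cDw : Continuous (fderiv ℝ w) := hw1'.continuous_fderiv one_ne_zero
  have cDu : Continuous (fderiv ℝ u) := hu1'.continuous_fderiv one_ne_zero
  have cDh : Continuous (fderiv ℝ h) := hh.continuous_fderiv one_ne_zero
  have hσ₂0 : 0 ≤ σ₂ := (norm_nonneg _).trans (hσ₂ 0)
  have hσ₃0 : 0 ≤ σ₃ := (norm_nonneg _).trans (hσ₃ 0)
  have hL0 : 0 ≤ L := (Real.sqrt_nonneg _).trans hL
  have hw0' : ∫⁻ x, ‖w x‖ₑ ^ 2 < ⊤ := by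
    refine lt_of_le_of_lt (le_of_eq (lintegral_congr fun x => ?_)) hw0
    rw [← ofReal_norm, ← ofReal_norm, norm_iteratedFDeriv_zero]
  have hwF : ∫⁻ x, ENNReal.ofReal (frobeniusNormSq (fderiv ℝ w x)) < ⊤ := by
    calc ∫⁻ x, ENNReal.ofReal (frobeniusNormSq (fderiv ℝ w x))
        ≤ ∫⁻ x, 3 * ‖iteratedFDeriv ℝ 1 w x‖ₑ ^ 2 := lintegral_mono fun x => by
          rw [← ofReal_norm, norm_iteratedFDeriv_one, ofReal_norm]
          exact ofReal_frobeniusNormSq_le_three_mul_enorm_sq _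
      _ = 3 * ∫⁻ x, ‖iteratedFDeriv ℝ 1 w x‖ₑ ^ 2 := lintegral_const_mul' _ _ (by norm_num)
      _ < ⊤ := ENNReal.mul_lt_top (by norm_num) hw1
  have hΔw2 : ∫⁻ x, ‖(Δ w) x‖ₑ ^ 2 < ⊤ := by
    have hle : ∀ x, ‖(Δ w) x‖ ≤ ‖(3 : ℝ) • iteratedFDeriv ℝ 2 w x‖ := fun x => by
      rw [norm_smul, Real.norm_of_nonneg (by norm_num : (0 : ℝ) ≤ 3)]
      exact norm_laplacian_le_three_mul_norm_iteratedFDeriv_two (hw.of_le (by norm_cast)) x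
    have h9 : ∫⁻ x, ‖(3 : ℝ) • iteratedFDeriv ℝ 2 w x‖ₑ ^ 2 < ⊤ := by
      have e3 : ∀ x, ‖(3 : ℝ) • iteratedFDeriv ℝ 2 w x‖ₑ ^ 2 =
          ENNReal.ofReal 3 ^ 2 * ‖iteratedFDeriv ℝ 2 w x‖ₑ ^ 2 := fun x => by
        rw [enorm_smul, mul_pow, Real.enorm_eq_ofReal (by norm_num : (0 : ℝ) ≤ 3)]
      simp_rw [e3]
      rw [lintegral_const_mul' _ _ (ENNReal.pow_ne_top ENNReal.ofReal_ne_top)]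
      exact ENNReal.mul_lt_top (lt_top_iff_ne_top.2 (ENNReal.pow_ne_top ENNReal.ofReal_ne_top)) hw2
    exact lintegral_enorm_sq_lt_top_of_norm_le hle h9
  -- the derivative slices `wᵢ = ∂ᵢw`, `uᵢ = ∂ᵢu` and their data
  have hws : ∀ i, ContDiff ℝ ∞ (fun y => fderiv ℝ w y (e i)) := fun i =>
    (hw.fderiv_right (m := ∞) (by simp)).clm_apply contDiff_const
  have hus : ∀ i, ContDiff ℝ ∞ (fun y => fderiv ℝ u y (e i)) := fun i =>
    (hu.fderiv_right (m := ∞) (by simp)).clm_apply contDiff_const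
  have hwsk : ∀ i (k : ℕ), (∫⁻ x, ‖iteratedFDeriv ℝ (k + 1) w x‖ₑ ^ 2 < ⊤) →
      ∫⁻ x, ‖iteratedFDeriv ℝ k (fun y => fderiv ℝ w y (e i)) x‖ₑ ^ 2 < ⊤ := fun i k hk =>
    lintegral_enorm_sq_lt_top_of_norm_le
      (fun x => norm_iteratedFDeriv_fderiv_apply_basisFun_le hw k le_top x i) hk
  have na : ∀ i x, ‖fderiv ℝ w x (e i)‖ ≤ ‖fderiv ℝ w x‖ := fun i x => by
    simpa [he1] using (fderiv ℝ w x).le_opNorm (e i)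
  have nus : ∀ i x, ‖fderiv ℝ u x (e i)‖ ≤ ‖iteratedFDeriv ℝ 1 u x‖ := fun i x => by
    have hDu_eq : ‖fderiv ℝ u x‖ = ‖iteratedFDeriv ℝ 1 u x‖ := by
      rw [← norm_iteratedFDeriv_fderiv, norm_iteratedFDeriv_zero]
    rw [← hDu_eq]
    simpa [he1] using (fderiv ℝ u x).le_opNorm (e i)
  have hb1 : ∀ i x, ‖fderiv ℝ (fun y => fderiv ℝ u y (e i)) x‖ ≤ σ₂ := fun i x => by
    have h : ‖fderiv ℝ (fun y => fderiv ℝ u y (e i)) x‖ =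
        ‖iteratedFDeriv ℝ 1 (fun y => fderiv ℝ u y (e i)) x‖ := by
      rw [← norm_iteratedFDeriv_fderiv, norm_iteratedFDeriv_zero]
    rw [h]
    exact (norm_iteratedFDeriv_fderiv_apply_basisFun_le hu 1 (by norm_cast) x i).trans (hσ₂ x)
  have hb1' : ∀ i x, ‖fderiv ℝ (fun y => fderiv ℝ u y (e i)) x‖ ≤ ‖iteratedFDeriv ℝ 2 u x‖ :=
    fun i x => by
    have h : ‖fderiv ℝ (fun y => fderiv ℝ u y (e i)) x‖ =
        ‖iteratedFDeriv ℝ 1 (fun y => fderiv ℝ u y (e i)) x‖ := by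
      rw [← norm_iteratedFDeriv_fderiv, norm_iteratedFDeriv_zero]
    rw [h]
    exact norm_iteratedFDeriv_fderiv_apply_basisFun_le hu 1 (by norm_cast) x i
  have hb2 : ∀ i x, ‖iteratedFDeriv ℝ 2 (fun y => fderiv ℝ u y (e i)) x‖ ≤ σ₃ := fun i x =>
    (norm_iteratedFDeriv_fderiv_apply_basisFun_le hu 2 (by norm_cast) x i).trans (hσ₃ x)
  have hbl0 : ∀ i, ∫⁻ x, ‖fderiv ℝ u x (e i)‖ₑ ^ 2 < ⊤ := fun i =>
    lintegral_enorm_sq_lt_top_of_norm_le (nus i) hu1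
  have hbl1 : ∀ i, ∫⁻ x, ‖fderiv ℝ (fun y => fderiv ℝ u y (e i)) x‖ₑ ^ 2 < ⊤ := fun i =>
    lintegral_enorm_sq_lt_top_of_norm_le (hb1' i) hu2
  -- freeze the scalar quantities
  obtain ⟨X₁, hX₁⟩ : ∃ X : ℝ, X = ∫ x, frobeniusNormSq (fderiv ℝ w x) := ⟨_, rfl⟩
  obtain ⟨Y₂, hY₂⟩ : ∃ Y : ℝ, Y = ∫ x, ‖(Δ w) x‖ ^ 2 := ⟨_, rfl⟩
  obtain ⟨H₁, hH₁⟩ : ∃ H : ℝ, H = ∫ x, ‖fderiv ℝ h x‖ ^ 2 := ⟨_, rfl⟩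
  have hA0 : 0 ≤ A := hA.nonneg
  have hX₁0 : 0 ≤ X₁ := by rw [hX₁]; exact integral_nonneg fun x => frobeniusNormSq_nonneg _
  have hY₂0 : 0 ≤ Y₂ := by rw [hY₂]; exact integral_nonneg fun x => sq_nonneg _
  have hH₁0 : 0 ≤ H₁ := by rw [hH₁]; exact integral_nonneg fun x => sq_nonneg _
  -- Agmon for `w`
  obtain ⟨Mw, hMw⟩ : ∃ M : ℝ, M = A * (X₁ * Y₂) ^ (1 / 4 : ℝ) := ⟨_, rfl⟩
  have hMw0 : 0 ≤ Mw := by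
    rw [hMw]; exact mul_nonneg hA0 (Real.rpow_nonneg (mul_nonneg hX₁0 hY₂0) _)
  have hMwx : ∀ x, ‖w x‖ ≤ Mw := fun x => by
    rw [hMw, hX₁, hY₂]
    exact hA.norm_le hw hwn x
  have hMw2 : Mw ^ 2 = A ^ 2 * Real.sqrt (X₁ * Y₂) := by
    have h4 : ((X₁ * Y₂) ^ (1 / 4 : ℝ)) ^ 2 = Real.sqrt (X₁ * Y₂) := by
      rw [← Real.rpow_natCast, ← Real.rpow_mul (mul_nonneg hX₁0 hY₂0), Real.sqrt_eq_rpow]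
      norm_num
    rw [hMw, mul_pow, h4]
  -- per-direction quantities and the per-direction bound
  have key : ∀ i,
      -(2 * ν * ∫ x, ‖(Δ (fun y => fderiv ℝ w y (e i))) x‖ ^ 2) +
        2 * (∫ x, ⟪fderiv ℝ (fun y => convect (fun z => u z + w z) w y + convect w u y) x (e i),
          (Δ (fun y => fderiv ℝ w y (e i))) x⟫) +
        2 * (∫ x, ⟪fderiv ℝ h x (e i), (Δ (fun y => fderiv ℝ w y (e i))) x⟫) +
        2 * (∫ x, ∑ j, ⟪fderiv ℝ (fun y => fderiv ℝ w y (e i)) x (e j),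
          convect (fun y => fderiv ℝ u y (e i)) (fun y => fderiv ℝ w y (e j)) x⟫) ≤
      (4 * G + 9 * κ * σ₂ + 3 * κ ^ 2 * σ₃ + 2 * A ^ 2 * Real.sqrt (X₁ * Y₂) / ν +
          27 * A ^ 4 * X₁ ^ 2 / (16 * ν ^ 3)) *
          (∫ x, frobeniusNormSq (fderiv ℝ (fun y => fderiv ℝ w y (e i)) x)) +
        9 * σ₂ / κ * X₁ + 3 * σ₃ / κ ^ 2 * L ^ 2 + 2 / ν * H₁ := by
    intro i
    -- the slice `a = ∂ᵢw`, `b = ∂ᵢu`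
    have ha := hws i
    have ha0 := hwsk i 0 hw1
    have ha1 := hwsk i 1 hw2
    have ha2 := hwsk i 2 hw3
    have ha3 := hwsk i 3 hw4
    have ha1' : ContDiff ℝ 1 (fun y => fderiv ℝ w y (e i)) := ha.of_le (by norm_cast)
    have cΔ : Continuous fun x => (Δ (fun y => fderiv ℝ w y (e i))) x :=
      (contDiff_one_laplacian_of_contDiff_three (ha.of_le (by norm_cast))).continuous
    have hΔ2 : ∫⁻ x, ‖(Δ (fun y => fderiv ℝ w y (e i))) x‖ₑ ^ 2 < ⊤ := by
      have hle : ∀ x, ‖(Δ (fun y => fderiv ℝ w y (e i))) x‖ ≤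
          ‖(3 : ℝ) • iteratedFDeriv ℝ 2 (fun y => fderiv ℝ w y (e i)) x‖ := fun x => by
        rw [norm_smul, Real.norm_of_nonneg (by norm_num : (0 : ℝ) ≤ 3)]
        exact norm_laplacian_le_three_mul_norm_iteratedFDeriv_two (ha.of_le (by norm_cast)) x
      have h9 : ∫⁻ x, ‖(3 : ℝ) • iteratedFDeriv ℝ 2 (fun y => fderiv ℝ w y (e i)) x‖ₑ ^ 2 < ⊤ := by
        have e3 : ∀ x, ‖(3 : ℝ) • iteratedFDeriv ℝ 2 (fun y => fderiv ℝ w y (e i)) x‖ₑ ^ 2 =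
            ENNReal.ofReal 3 ^ 2 * ‖iteratedFDeriv ℝ 2 (fun y => fderiv ℝ w y (e i)) x‖ₑ ^ 2 :=
          fun x => by
          rw [enorm_smul, mul_pow, Real.enorm_eq_ofReal (by norm_num : (0 : ℝ) ≤ 3)]
        simp_rw [e3]
        rw [lintegral_const_mul' _ _ (ENNReal.pow_ne_top ENNReal.ofReal_ne_top)]
        exact ENNReal.mul_lt_top (lt_top_iff_ne_top.2 (ENNReal.pow_ne_top ENNReal.ofReal_ne_top)) ha2
      exact lintegral_enorm_sq_lt_top_of_norm_le hle h9
    obtain ⟨-, hP⟩ := r3rob_H2_pairings hu hw ha (hus i) hdivu hB hB₁ hG hσ₂ (hb1 i) (hb2 i)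
      (hbl0 i) (hbl1 i) hw0' hw1 hBw₁ hBw₂ hMw0 hMwx hL hA (fun n => hwsk i n (hwn (n + 1))) (na i)
    rw [← hX₁] at hP
    -- the derivative of the nonlinearity in direction `eᵢ`
    have hv : ContDiff ℝ ∞ (fun z => u z + w z) := hu.add hw
    have hdN : ∀ x, fderiv ℝ (fun y => convect (fun z => u z + w z) w y + convect w u y) x (e i) =
        convect u (fun y => fderiv ℝ w y (e i)) x + convect w (fun y => fderiv ℝ w y (e i)) x +
          convect (fun y => fderiv ℝ w y (e i)) u x + convect w (fun y => fderiv ℝ u y (e i)) x +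
          fderiv ℝ w x (fderiv ℝ u x (e i)) + fderiv ℝ w x (fderiv ℝ w x (e i)) := by
      intro x
      have d1 : DifferentiableAt ℝ (convect (fun z => u z + w z) w) x :=
        (((hw.fderiv_right (m := ∞) (by simp)).clm_apply hv).differentiable (by simp)) x
      have d2 : DifferentiableAt ℝ (convect w u) x :=
        (((hu.fderiv_right (m := ∞) (by simp)).clm_apply hw).differentiable (by simp)) x
      rw [fderiv_fun_add d1 d2, _root_.add_apply,
        fderiv_convect_apply_of_contDiff hv hw x (e i), fderiv_convect_apply_of_contDiff hw hu x (e i)]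
      have hDv : fderiv ℝ (fun z => u z + w z) x = fderiv ℝ u x + fderiv ℝ w x :=
        fderiv_fun_add ((hu.differentiable (by simp)) x) ((hw.differentiable (by simp)) x)
      rw [hDv]
      simp only [convect, _root_.add_apply, map_add]
      abel
    have hPN : (∫ x, ⟪fderiv ℝ (fun y => convect (fun z => u z + w z) w y + convect w u y) x (e i),
        (Δ (fun y => fderiv ℝ w y (e i))) x⟫) =
        ∫ x, ⟪convect u (fun y => fderiv ℝ w y (e i)) x + convect w (fun y => fderiv ℝ w y (e i)) x +
          convect (fun y => fderiv ℝ w y (e i)) u x + convect w (fun y => fderiv ℝ u y (e i)) x +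
          fderiv ℝ w x (fderiv ℝ u x (e i)) + fderiv ℝ w x (fderiv ℝ w x (e i)),
          (Δ (fun y => fderiv ℝ w y (e i))) x⟫ :=
      integral_congr_ae (Eventually.of_forall fun x => by
        show ⟪_, _⟫ = ⟪_, _⟫
        rw [hdN x])
    rw [hPN]
    -- the forcing pairing
    have hF : ∫ x, ⟪fderiv ℝ h x (e i), (Δ (fun y => fderiv ℝ w y (e i))) x⟫ ≤
        Real.sqrt H₁ * Real.sqrt (∫ x, ‖(Δ (fun y => fderiv ℝ w y (e i))) x‖ ^ 2) := by
      have nh : ∀ x, ‖fderiv ℝ h x (e i)‖ ≤ ‖fderiv ℝ h x‖ := fun x => by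
        simpa [he1] using (fderiv ℝ h x).le_opNorm (e i)
      have chi : Continuous fun x => fderiv ℝ h x (e i) := cDh.clm_apply continuous_const
      have l2hi : ∫⁻ x, ‖fderiv ℝ h x (e i)‖ₑ ^ 2 < ⊤ := lintegral_enorm_sq_lt_top_of_norm_le nh hh1
      have mh : MemLp (fun x => fderiv ℝ h x (e i)) 2 volume := r3rob_memLp_two chi l2hi
      have mΔ : MemLp (fun x => (Δ (fun y => fderiv ℝ w y (e i))) x) 2 volume := r3rob_memLp_two cΔ hΔ2
      have hcs := integral_norm_mul_norm_le_sqrt_mul_sqrt mh mΔ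
      have hH : Real.sqrt (∫ x, ‖fderiv ℝ h x (e i)‖ ^ 2) ≤ Real.sqrt H₁ := by
        refine Real.sqrt_le_sqrt ?_
        rw [hH₁]
        exact integral_mono (FluidPDE.integrable_sq_norm_of_lintegral_lt_top chi l2hi)
          (FluidPDE.integrable_sq_norm_of_lintegral_lt_top cDh hh1)
          fun x => pow_le_pow_left₀ (norm_nonneg _) (nh x) 2
      by_cases hint : Integrable (fun x => ⟪fderiv ℝ h x (e i), (Δ (fun y => fderiv ℝ w y (e i))) x⟫)
        volume
      · refine le_trans (integral_mono hint ?_ fun x => real_inner_le_norm _ _)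
          (hcs.trans (mul_le_mul_of_nonneg_right hH (Real.sqrt_nonneg _)))
        exact integrable_of_norm_le_mul_of_lintegral_sq ((chi.norm.mul cΔ.norm).aestronglyMeasurable)
          chi cΔ l2hi hΔ2 (fun x => by
            rw [Real.norm_of_nonneg (mul_nonneg (norm_nonneg _) (norm_nonneg _))])
      · rw [integral_undef hint]; positivity
    -- scalar bookkeeping
    obtain ⟨Xa, hXa⟩ : ∃ X : ℝ, X = ∫ x, frobeniusNormSq (fderiv ℝ (fun y => fderiv ℝ w y (e i)) x) :=
      ⟨_, rfl⟩
    obtain ⟨Ya, hYa⟩ : ∃ Y : ℝ, Y = ∫ x, ‖(Δ (fun y => fderiv ℝ w y (e i))) x‖ ^ 2 := ⟨_, rfl⟩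
    rw [← hXa, ← hYa] at hP
    rw [← hYa] at hF
    rw [← hXa, ← hYa]
    have hXa0 : 0 ≤ Xa := by rw [hXa]; exact integral_nonneg fun x => frobeniusNormSq_nonneg _
    have hYa0 : 0 ≤ Ya := by rw [hYa]; exact integral_nonneg fun x => sq_nonneg _
    -- Young / AM–GM
    have y1 : Mw * Real.sqrt Xa * Real.sqrt Ya ≤ ν / 4 * Ya + Mw ^ 2 * Xa / ν :=
      r3rob_young_two hν hXa0 hYa0
    have y2 : Real.sqrt H₁ * Real.sqrt Ya ≤ ν / 4 * Ya + H₁ / ν := by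
      have h := r3rob_young_two (M := 1) hν hH₁0 hYa0
      rw [one_mul, one_pow, one_mul] at h
      exact h
    have hν2 : 0 < ν / 2 := by positivity
    have y3 : A * (Xa * Ya) ^ (1 / 4 : ℝ) * Real.sqrt X₁ * Real.sqrt Ya ≤
        ν / 2 * Ya + 27 * (A ^ 4 * X₁ ^ 2 * Xa) / (256 * (ν / 2) ^ 3) := by
      refine r3rob_young_quartic (by positivity) (by positivity) hYa0 hν2 ?_
      have h4 : ((Xa * Ya) ^ (1 / 4 : ℝ)) ^ 4 = Xa * Ya := by
        rw [← Real.rpow_natCast, ← Real.rpow_mul (mul_nonneg hXa0 hYa0)]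
        norm_num
      have eq : (A * (Xa * Ya) ^ (1 / 4 : ℝ) * Real.sqrt X₁ * Real.sqrt Ya) ^ 4 =
          A ^ 4 * ((Xa * Ya) ^ (1 / 4 : ℝ)) ^ 4 * (Real.sqrt X₁ ^ 2) ^ 2 * (Real.sqrt Ya ^ 2) ^ 2 := by
        ring
      rw [eq, h4, Real.sq_sqrt hX₁0, Real.sq_sqrt hYa0]
      exact le_of_eq (by ring)
    have y4 : 2 * Real.sqrt X₁ * Real.sqrt Xa ≤ κ * Xa + X₁ / κ := by
      have h := r3rob_two_mul_le_kappa (L := Real.sqrt X₁) (s := Real.sqrt Xa) hκ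
      rwa [Real.sq_sqrt hXa0, Real.sq_sqrt hX₁0] at h
    have y5 : 2 * L * Real.sqrt Xa ≤ κ ^ 2 * Xa + L ^ 2 / κ ^ 2 := by
      have h := r3rob_two_mul_le_kappa (L := L) (s := Real.sqrt Xa) (pow_pos hκ 2)
      rwa [Real.sq_sqrt hXa0] at h
    generalize (∫ x, ⟪convect u (fun y => fderiv ℝ w y (e i)) x +
        convect w (fun y => fderiv ℝ w y (e i)) x + convect (fun y => fderiv ℝ w y (e i)) u x +
        convect w (fun y => fderiv ℝ u y (e i)) x + fderiv ℝ w x (fderiv ℝ u x (e i)) +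
        fderiv ℝ w x (fderiv ℝ w x (e i)), (Δ (fun y => fderiv ℝ w y (e i))) x⟫) = P at hP ⊢
    generalize (∫ x, ∑ j, ⟪fderiv ℝ (fun y => fderiv ℝ w y (e i)) x (e j),
        convect (fun y => fderiv ℝ u y (e i)) (fun y => fderiv ℝ w y (e j)) x⟫) = S at hP ⊢
    generalize (∫ x, ⟪fderiv ℝ h x (e i), (Δ (fun y => fderiv ℝ w y (e i))) x⟫) = F at hF ⊢
    have hid1 : 27 * (A ^ 4 * X₁ ^ 2 * Xa) / (256 * (ν / 2) ^ 3) =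
        27 * A ^ 4 * X₁ ^ 2 / (32 * ν ^ 3) * Xa := by
      field_simp
      ring
    rw [hid1] at y3
    have hc1 : 9 * σ₂ * Real.sqrt X₁ * Real.sqrt Xa ≤ 9 / 2 * σ₂ * (κ * Xa + X₁ / κ) := by
      have := mul_le_mul_of_nonneg_left y4 (by positivity : (0 : ℝ) ≤ 9 / 2 * σ₂)
      linarith [this]
    have hc2 : 3 * σ₃ * L * Real.sqrt Xa ≤ 3 / 2 * σ₃ * (κ ^ 2 * Xa + L ^ 2 / κ ^ 2) := by
      have := mul_le_mul_of_nonneg_left y5 (by positivity : (0 : ℝ) ≤ 3 / 2 * σ₃)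
      linarith [this]
    rw [hMw2] at y1
    have hid2 : (4 * G + 9 * κ * σ₂ + 3 * κ ^ 2 * σ₃ + 2 * A ^ 2 * Real.sqrt (X₁ * Y₂) / ν +
          27 * A ^ 4 * X₁ ^ 2 / (16 * ν ^ 3)) * Xa +
        9 * σ₂ / κ * X₁ + 3 * σ₃ / κ ^ 2 * L ^ 2 + 2 / ν * H₁ =
        -(2 * ν * Ya) +
          2 * (2 * G * Xa + 9 / 2 * σ₂ * (κ * Xa + X₁ / κ) + 3 / 2 * σ₃ * (κ ^ 2 * Xa + L ^ 2 / κ ^ 2) +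
            (ν / 4 * Ya + A ^ 2 * Real.sqrt (X₁ * Y₂) * Xa / ν) +
            (ν / 2 * Ya + 27 * A ^ 4 * X₁ ^ 2 / (32 * ν ^ 3) * Xa)) +
          2 * (ν / 4 * Ya + H₁ / ν) := by
      field_simp
      ring
    rw [hid2]
    linarith [hP, hF, y1, y2, y3, hc1, hc2]
  -- the symmetric term over all directions
  have hI : ∀ i, Integrable (fun x => ∑ j, ⟪fderiv ℝ (fun y => fderiv ℝ w y (e i)) x (e j),
      convect (fun y => fderiv ℝ u y (e i)) (fun y => fderiv ℝ w y (e j)) x⟫) volume := fun i =>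
    (r3rob_H2_pairings hu hw (hws i) (hus i) hdivu hB hB₁ hG hσ₂ (hb1 i) (hb2 i)
      (hbl0 i) (hbl1 i) hw0' hw1 hBw₁ hBw₂ hMw0 hMwx hL hA (fun n => hwsk i n (hwn (n + 1)))
      (na i)).1
  have hFr : ∀ j, Integrable (fun x => frobeniusNormSq
      (fderiv ℝ (fun y => fderiv ℝ w y (e j)) x)) volume := fun j => by
    have hj1 : ContDiff ℝ 1 (fun y => fderiv ℝ w y (e j)) := (hws j).of_le (by norm_cast)
    refine integrable_of_continuous_of_nonneg
      (FluidPDE.continuous_frobeniusNormSq_fderiv hj1 one_ne_zero) (fun x => frobeniusNormSq_nonneg _) ?_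
    calc ∫⁻ x, ENNReal.ofReal (frobeniusNormSq (fderiv ℝ (fun y => fderiv ℝ w y (e j)) x))
        ≤ ∫⁻ x, 3 * ‖iteratedFDeriv ℝ 1 (fun y => fderiv ℝ w y (e j)) x‖ₑ ^ 2 :=
          lintegral_mono fun x => by
            rw [← ofReal_norm, norm_iteratedFDeriv_one, ofReal_norm]
            exact ofReal_frobeniusNormSq_le_three_mul_enorm_sq _
      _ = 3 * ∫⁻ x, ‖iteratedFDeriv ℝ 1 (fun y => fderiv ℝ w y (e j)) x‖ₑ ^ 2 :=
          lintegral_const_mul' _ _ (by norm_num)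
      _ < ⊤ := ENNReal.mul_lt_top (by norm_num) (hwsk j 1 hw2)
  have hsym := r3rob_H2_symmetric_le (u := u) hw hG hI hFr
  -- sum the three directions
  have k0 := key 0
  have k1 := key 1
  have k2 := key 2
  rw [Fin.sum_univ_three, Fin.sum_univ_three] at hsym
  rw [Fin.sum_univ_three, Fin.sum_univ_three]
  rw [← hX₁, ← hY₂, ← hH₁]
  exact r3rob_H2_sum3 k0 k1 k2 hsym

end H2

end Literature.Analysis.FluidPDE
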